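import Literature.Geometry.Symplectic.SteinOneHandlebodies
import Literature.Geometry.Symplectic.SteinBall
import Literature.Topology.FourManifolds.LefschetzBaseRegular
import HarnessLib

/-!
# A strictly pseudoconvex model of the Lefschetz base `F_{g,1} × D²` in `ℂ²`
# (the base case `h = ∅` of "PALF ⇒ Stein, supported by the Kas open book": Torisu 2000;
# Etnyre 2006, proof of Thm. 5.6, first paragraph)

Topic `Literature/Geometry/Symplectic`; namespace `Literature.Geometry.Symplectic.LefschetzBaseSteinModel`.
Infrastructure for the named fact `Literature.Geometry.Symplectic.palf_stein_supportedByBoundaryOpenBook`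
(`LefschetzSteinOpenBook.lean`, Akbulut–Ozbagci 2001 Thm. 5 with Gay 2002 Prop. 2.8), whose proof is
the printed induction over the Lefschetz 2-handles starting from the BASE CASE: *"we can assume that
`X_{i-1}` has a Stein structure, with a convex fiber `F ⊂ ∂X_{i-1}`. By [Torisu] we can start the
induction"* (Akbulut–Ozbagci, proof of Thm. 5, arXiv:math/0012239 p. 8); *"the Stein filling of
`(M_{(Σ,id)}, ξ_{(Σ,id)})` … `♮^{2g} S¹ × B³`"* (Etnyre 2006, proof of Thm. 5.6).  In the tree's
concrete vocabulary the base is the compact domain `Base g = {rho g ≤ 1/4} ⊂ ℂ²`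
(`LefschetzBaseRegular.lean`, `rho = ‖w‖² + eta ‖x‖²`, `w = y² - x^{2g+1} - 1`), which is NOT
strictly pseudoconvex for the standard complex structure: its vertical boundary
`{‖w‖ = 1/2, ‖x‖ < 2}` is foliated by the holomorphic pages `w = const`.  This file supplies a
strictly pseudoconvex MODEL of it and the Stein structure on that model; the identification with
`Base g` (an `arg w`-preserving diffeomorphism) and the Giroux compatibility of the model's boundary
contact structure with the open book `({w = 0}, arg w)` are the business of the sequels.  Everything
here is **proved**; the file defines vocabulary (`ell`, `modelPsi`, `wD`, …) and introduces NO named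
fact.

## Contents

* §1 complex-coordinate calculus on `ℝ⁴ = ℂ²` for the standard complex structure
  `J₀ = stdComplexStructure` (`SteinBall.lean`; `cx (J₀ v) = i · cx v`, `cy (J₀ v) = i · cy v`): the
  derivative `wD g p` of the polynomial `w g` (`hasFDerivAt_w`), its holomorphy
  `Dw(J₀ v) = i Dw(v)` (`wD_J`), its second derivative `wDD` (`hasFDerivAt_wD_apply`) with
  `D²w(J₀ a, J₀ b) = -D²w(a, b)`;
* §2 the saturating cut-off `ell b = e⁻¹ - expNegInvGlue (1 - b)` (`ell 0 = 0`, `0 ≤ ell ≤ e⁻¹`,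
  `ell' > 0` on `b < 1`, `ell = e⁻¹` and `ell' = 0` for `b ≥ 1`) and the **model potential**
  `modelPsi g ε ε' = ‖w‖² + ε ‖x‖² + ε' ell (‖y‖²)`, its first derivative (`hasFDerivAt_modelPsi`)
  and its **flat Levi form**
  `D²Ψ(u,u) + D²Ψ(J₀u,J₀u) = 4‖Dw u‖² + 4ε‖cx u‖² + 4ε'(ell' + b ell'')(‖cy p‖²) ‖cy u‖²`
  (`levi_modelPsi`);
* §3 **strict plurisubharmonicity** on `{‖w‖ ≤ 1}` for `0 < ε ≤ 1`, `0 < ε' ≤ ε / (300 (2g+1)²)`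
  (`levi_modelPsi_pos`): off the zone `‖y‖² ∈ (0, 1)` the cut-off term is non-negative and
  `4‖Dw u‖² + 4ε‖cx u‖²` is definite up to the direction `∂_y` at `y = 0`, where `ell'(0) = e⁻¹ > 0`
  acts; on the zone, `‖y‖² ≥ 1/2` or the term is non-negative, and the explicit bound
  `|ell' + b ell''| ≤ 72` is absorbed by `min_{u_x} (4‖w_x u_x + 2y u_y‖² + 4ε‖u_x‖²) = 16ε‖y‖²‖u_y‖²/(‖w_x‖² + ε)`;
* §4 a `SteinStructure` on a regular sublevel set `{f ≤ c} ⊂ ℝ⁴` from a flat strictly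
  plurisubharmonic POTENTIAL `Ψ` presenting the same boundary (`steinStructureOfFlatPotential`;
  the §4 dictionary of `SteinOneHandlebodies.lean` with the potential decoupled from the defining
  function, which the sequel needs for the sublevel set `{rho ∘ Φ⁻¹ ≤ 1/4}`).

## References
* I. Torisu, *Convex contact structures and fibered links in 3-manifolds*, IMRN 2000:9, 441–454.
  [Torisu2000]
* J. B. Etnyre, *Lectures on open book decompositions and contact structures*, Clay Math. Proc. 5
  (2006), proof of Thm. 5.6 (arXiv:math/0409402). [Etnyre2006]
* S. Akbulut, B. Ozbagci, *Lefschetz fibrations on compact Stein surfaces*, Geom. Topol. 5 (2001),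
  proof of Thm. 5. [AkbulutOzbagci2001]
* K. Cieliebak, Ya. Eliashberg, *From Stein to Weinstein and Back*, AMS Colloquium Publ. 59 (2012),
  §2.2 (the Levi form `-dd^ℂφ`; `i`-convex functions `|f|²`, `f` holomorphic). [CieliebakEliashberg2012]
-/

noncomputable section

open scoped Manifold ContDiff Topology ComplexConjugate
open Set Function Metric

namespace Literature.Geometry.Symplectic

open Literature.Topology.FourManifolds Literature.Topology.FourManifolds.LefschetzBase

namespace LefschetzBaseSteinModel

/-! ### §1 Complex-coordinate calculus on `ℝ⁴ = ℂ²` -/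

/-- `J₀` is multiplication by `i` on the first complex coordinate. [folklore] -/
@[simp] theorem cx_J (v : EuclideanSpace ℝ (Fin 4)) : cx (stdComplexStructure v) = Complex.I * cx v := by
  apply Complex.ext <;> simp [cx]

/-- `J₀` is multiplication by `i` on the second complex coordinate. [folklore] -/
@[simp] theorem cy_J (v : EuclideanSpace ℝ (Fin 4)) : cy (stdComplexStructure v) = Complex.I * cy v := by
  apply Complex.ext <;> simp [cy]

/-- `cx` has derivative `cxL`. [folklore] -/
theorem hasFDerivAt_cx (p : EuclideanSpace ℝ (Fin 4)) : HasFDerivAt cx cxL p := by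
  rw [cx_eq]; exact cxL.hasFDerivAt

/-- `cy` has derivative `cyL`. [folklore] -/
theorem hasFDerivAt_cy (p : EuclideanSpace ℝ (Fin 4)) : HasFDerivAt cy cyL p := by
  rw [cy_eq]; exact cyL.hasFDerivAt

/-- **The derivative of `w g` at `p`** as a real-linear map `ℝ⁴ → ℂ`:
`Dw_p = 2y · dy - (2g+1) x^{2g} · dx`. [folklore] -/
def wD (g : ℕ) (p : EuclideanSpace ℝ (Fin 4)) : EuclideanSpace ℝ (Fin 4) →L[ℝ] ℂ :=
  (2 * cy p) • cyL - (((2 * g + 1 : ℕ) : ℂ) * cx p ^ (2 * g)) • cxL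

/-- `Dw_p(v) = 2 y y(v) - (2g+1) x^{2g} x(v)`. [folklore] -/
@[simp] theorem wD_apply (g : ℕ) (p v : EuclideanSpace ℝ (Fin 4)) :
    wD g p v = 2 * cy p * cy v - ((2 * g + 1 : ℕ) : ℂ) * cx p ^ (2 * g) * cx v := by
  simp [wD, smul_eq_mul]

/-- **`w g` has derivative `wD g p` at `p`.** [folklore] -/
theorem hasFDerivAt_w (g : ℕ) (p : EuclideanSpace ℝ (Fin 4)) : HasFDerivAt (w g) (wD g p) p := by
  have h1 := (hasFDerivAt_cy p).pow 2
  have h2 := (hasFDerivAt_cx p).pow (2 * g + 1)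
  have h : HasFDerivAt (fun q => cy q ^ 2 - cx q ^ (2 * g + 1) - 1)
      ((2 • cy p ^ (2 - 1)) • cyL - ((2 * g + 1) • cx p ^ (2 * g + 1 - 1)) • cxL) p :=
    (h1.sub h2).sub_const (1 : ℂ)
  have hfun : (fun q => cy q ^ 2 - cx q ^ (2 * g + 1) - 1) = w g := by
    funext q; rfl
  rw [hfun] at h
  refine h.congr_fderiv ?_
  have e1 : 2 * g + 1 - 1 = 2 * g := by omega
  ext v
  simp [wD, smul_eq_mul, nsmul_eq_mul, e1]

/-- `fderiv` of `w g`. [folklore] -/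
theorem fderiv_w (g : ℕ) (p : EuclideanSpace ℝ (Fin 4)) : fderiv ℝ (w g) p = wD g p :=
  (hasFDerivAt_w g p).fderiv

/-- **Holomorphy of `w`**: `Dw_p (J₀ v) = i · Dw_p (v)`. [folklore] -/
theorem wD_J (g : ℕ) (p v : EuclideanSpace ℝ (Fin 4)) :
    wD g p (stdComplexStructure v) = Complex.I * wD g p v := by
  simp only [wD_apply, cx_J, cy_J]
  ring

/-- **The second derivative of `w g` at `p`**, as the symmetric real-bilinear expression
`D²w_p(a, b) = 2 y(a) y(b) - (2g+1)(2g) x^{2g-1} x(a) x(b)`. [folklore] -/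
def wDD (g : ℕ) (p a b : EuclideanSpace ℝ (Fin 4)) : ℂ :=
  2 * cy a * cy b - ((2 * g + 1 : ℕ) : ℂ) * ((2 * g : ℕ) : ℂ) * cx p ^ (2 * g - 1) * cx a * cx b

/-- `D²w` is symmetric. [folklore] -/
theorem wDD_comm (g : ℕ) (p a b : EuclideanSpace ℝ (Fin 4)) : wDD g p a b = wDD g p b a := by
  simp only [wDD]; ring

/-- **`D²w(J₀ a, J₀ b) = -D²w(a, b)`** (the complex Hessian of a holomorphic function is
complex-bilinear). [folklore] -/
theorem wDD_J (g : ℕ) (p a b : EuclideanSpace ℝ (Fin 4)) :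
    wDD g p (stdComplexStructure a) (stdComplexStructure b) = -wDD g p a b := by
  simp only [wDD, cx_J, cy_J]
  have hI : Complex.I * Complex.I = -1 := Complex.I_mul_I
  linear_combination (2 * cy a * cy b -
    ((2 * g + 1 : ℕ) : ℂ) * ((2 * g : ℕ) : ℂ) * cx p ^ (2 * g - 1) * cx a * cx b) * hI

/-- **The evaluated derivative `p ↦ Dw_p(b)` has derivative `a ↦ D²w_p(a, b)`.** [folklore] -/
theorem hasFDerivAt_wD_apply (g : ℕ) (p b : EuclideanSpace ℝ (Fin 4)) :
    HasFDerivAt (fun q => wD g q b)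
      ((2 * cy b) • cyL -
        (((2 * g + 1 : ℕ) : ℂ) * ((2 * g : ℕ) : ℂ) * cx p ^ (2 * g - 1) * cx b) • cxL) p := by
  have h1 : HasFDerivAt (fun q => 2 * cy q * cy b) ((2 * cy b) • cyL) p := by
    have h := ((hasFDerivAt_cy p).const_mul (2 : ℂ)).mul_const (cy b)
    refine h.congr_fderiv ?_
    ext v
    simp [smul_eq_mul]
    ring
  have h2 : HasFDerivAt (fun q => ((2 * g + 1 : ℕ) : ℂ) * cx q ^ (2 * g) * cx b)
      ((((2 * g + 1 : ℕ) : ℂ) * ((2 * g : ℕ) : ℂ) * cx p ^ (2 * g - 1) * cx b) • cxL) p := by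
    have h := (((hasFDerivAt_cx p).pow (2 * g)).const_mul (((2 * g + 1 : ℕ) : ℂ))).mul_const (cx b)
    refine h.congr_fderiv ?_
    ext v
    simp [smul_eq_mul, nsmul_eq_mul]
    ring
  have h := h1.sub h2
  refine (h.congr_of_eventuallyEq ?_)
  exact Filter.Eventually.of_forall fun q => by simp [wD_apply]

/-- The same, evaluated: `D(q ↦ Dw_q(b))_p (a) = D²w_p(a, b)`. [folklore] -/
theorem fderiv_wD_apply (g : ℕ) (p a b : EuclideanSpace ℝ (Fin 4)) :
    fderiv ℝ (fun q => wD g q b) p a = wDD g p a b := by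
  rw [(hasFDerivAt_wD_apply g p b).fderiv]
  simp [wDD, smul_eq_mul]
  ring

/-- The real functional `v ↦ Re (z · L v)` for a complex number `z` and a real-linear `L : ℝ⁴ → ℂ`
(for `z = conj a` this is `v ↦ ⟪a, L v⟫_ℝ`). [folklore] -/
def reMul (z : ℂ) (L : EuclideanSpace ℝ (Fin 4) →L[ℝ] ℂ) : EuclideanSpace ℝ (Fin 4) →L[ℝ] ℝ :=
  Complex.reCLM.comp ((ContinuousLinearMap.mul ℝ ℂ z).comp L)

/-- Unfolding `reMul`. [folklore] -/
@[simp] theorem reMul_apply (z : ℂ) (L : EuclideanSpace ℝ (Fin 4) →L[ℝ] ℂ) (v : EuclideanSpace ℝ (Fin 4)) :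
    reMul z L v = (z * L v).re := rfl

/-- `‖x‖²` has derivative `v ↦ 2 Re(x̄ x(v))`. [folklore] -/
theorem hasFDerivAt_norm_sq_cx (p : EuclideanSpace ℝ (Fin 4)) :
    HasFDerivAt (fun q => ‖cx q‖ ^ 2) ((2 : ℝ) • reMul (conj (cx p)) cxL) p := by
  have h := (hasFDerivAt_cx p).norm_sq
  refine h.congr_fderiv ?_
  ext v
  simp [Complex.inner, mul_comm]
  ring

/-- `‖y‖²` has derivative `v ↦ 2 Re(ȳ y(v))`. [folklore] -/
theorem hasFDerivAt_norm_sq_cy (p : EuclideanSpace ℝ (Fin 4)) :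
    HasFDerivAt (fun q => ‖cy q‖ ^ 2) ((2 : ℝ) • reMul (conj (cy p)) cyL) p := by
  have h := (hasFDerivAt_cy p).norm_sq
  refine h.congr_fderiv ?_
  ext v
  simp [Complex.inner, mul_comm]
  ring

/-- `‖w‖²` has derivative `v ↦ 2 Re(w̄ Dw(v))`. [folklore] -/
theorem hasFDerivAt_norm_sq_w (g : ℕ) (p : EuclideanSpace ℝ (Fin 4)) :
    HasFDerivAt (fun q => ‖w g q‖ ^ 2) ((2 : ℝ) • reMul (conj (w g p)) (wD g p)) p := by
  have h := (hasFDerivAt_w g p).norm_sq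
  refine h.congr_fderiv ?_
  ext v
  simp [Complex.inner, mul_comm]
  ring

/-! ### §2 The saturating cut-off `ell` and the model potential `modelPsi` -/

/-- **The saturating cut-off** `ell b = e⁻¹ - expNegInvGlue (1 - b)`: equal to `b ↦ e⁻¹ - e^{-1/(1-b)}`
for `b < 1` (so `ell 0 = 0`, `ell' > 0`) and to the constant `e⁻¹` for `b ≥ 1`. [folklore] -/
def ell (b : ℝ) : ℝ := Real.exp (-1) - expNegInvGlue (1 - b)

/-- `ell` below `1`. [folklore] -/
theorem ell_eq_of_lt {b : ℝ} (hb : b < 1) : ell b = Real.exp (-1) - Real.exp (-(1 - b)⁻¹) := by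
  simp [ell, expNegInvGlue, not_le.2 (sub_pos.2 hb)]

/-- `ell` is the constant `e⁻¹` beyond `1`. [folklore] -/
theorem ell_eq_of_le {b : ℝ} (hb : 1 ≤ b) : ell b = Real.exp (-1) := by
  simp [ell, expNegInvGlue.zero_of_nonpos (sub_nonpos.2 hb)]

/-- `ell 0 = 0`. [folklore] -/
@[simp] theorem ell_zero : ell 0 = 0 := by
  rw [ell_eq_of_lt one_pos]; simp

/-- `ell ≤ e⁻¹`. [folklore] -/
theorem ell_le (b : ℝ) : ell b ≤ Real.exp (-1) := by
  have := expNegInvGlue.nonneg (1 - b)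
  simp only [ell]; linarith

/-- `0 ≤ ell b` for `0 ≤ b`. [folklore] -/
theorem ell_nonneg {b : ℝ} (hb : 0 ≤ b) : 0 ≤ ell b := by
  rcases lt_or_ge b 1 with h | h
  · rw [ell_eq_of_lt h, sub_nonneg]
    apply Real.exp_le_exp.2
    have h1 : 0 < 1 - b := sub_pos.2 h
    have h2 : 1 ≤ (1 - b)⁻¹ := by
      rw [one_le_inv₀ h1]; linarith
    linarith
  · rw [ell_eq_of_le h]; exact (Real.exp_pos _).le

/-- `ell` is smooth. [folklore] -/
theorem contDiff_ell : ContDiff ℝ ∞ ell :=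
  contDiff_const.sub (expNegInvGlue.contDiff.comp (contDiff_const.sub contDiff_id))

/-- `ell` is differentiable. [folklore] -/
theorem differentiable_ell : Differentiable ℝ ell := contDiff_ell.differentiable (by simp)

/-- `deriv ell` is smooth. [folklore] -/
theorem contDiff_deriv_ell : ContDiff ℝ ∞ (deriv ell) := contDiff_ell.iterate_deriv 1

/-- `deriv ell` is differentiable. [folklore] -/
theorem differentiable_deriv_ell : Differentiable ℝ (deriv ell) :=
  contDiff_deriv_ell.differentiable (by simp)

/-- **The derivative of `ell` below `1`**: `ell' b = e^{-1/(1-b)} / (1-b)² > 0`. [folklore] -/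
theorem hasDerivAt_ell_of_lt {b : ℝ} (hb : b < 1) :
    HasDerivAt ell (Real.exp (-(1 - b)⁻¹) * (1 - b)⁻¹ ^ 2) b := by
  have hne : 1 - b ≠ 0 := (sub_pos.2 hb).ne'
  have h1 : HasDerivAt (fun u : ℝ => -(1 - u)⁻¹) (-((1 - b)⁻¹ ^ 2)) b := by
    have h0 : HasDerivAt (fun u : ℝ => -(1 - u)⁻¹) (-(-(0 - 1) / (1 - b) ^ 2)) b :=
      (((hasDerivAt_const b (1 : ℝ)).sub (hasDerivAt_id' b)).inv hne).neg
    have he : -(-(0 - 1) / (1 - b) ^ 2) = -((1 - b)⁻¹ ^ 2) := by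
      rw [inv_pow]; ring
    rwa [he] at h0
  have h2 : HasDerivAt (fun u : ℝ => Real.exp (-1) - Real.exp (-(1 - u)⁻¹))
      (0 - Real.exp (-(1 - b)⁻¹) * -((1 - b)⁻¹ ^ 2)) b := (hasDerivAt_const _ _).sub h1.exp
  have he2 : (0 - Real.exp (-(1 - b)⁻¹) * -((1 - b)⁻¹ ^ 2)) = Real.exp (-(1 - b)⁻¹) * (1 - b)⁻¹ ^ 2 := by
    ring
  rw [he2] at h2
  refine h2.congr_of_eventuallyEq ?_
  filter_upwards [gt_mem_nhds hb] with u hu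
  exact ell_eq_of_lt hu

/-- `deriv ell` below `1`. [folklore] -/
theorem deriv_ell_of_lt {b : ℝ} (hb : b < 1) : deriv ell b = Real.exp (-(1 - b)⁻¹) * (1 - b)⁻¹ ^ 2 :=
  (hasDerivAt_ell_of_lt hb).deriv

/-- `ell' > 0` below `1`. [folklore] -/
theorem deriv_ell_pos_of_lt {b : ℝ} (hb : b < 1) : 0 < deriv ell b := by
  rw [deriv_ell_of_lt hb]
  exact mul_pos (Real.exp_pos _) (pow_pos (inv_pos.2 (sub_pos.2 hb)) 2)

/-- `ell' 0 = e⁻¹`. [folklore] -/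
theorem deriv_ell_zero : deriv ell 0 = Real.exp (-1) := by
  rw [deriv_ell_of_lt one_pos]; simp

/-- `ell' = 0` beyond `1` (strictly). [folklore] -/
theorem deriv_ell_of_gt {b : ℝ} (hb : 1 < b) : deriv ell b = 0 := by
  have h : ell =ᶠ[𝓝 b] fun _ => Real.exp (-1) := by
    filter_upwards [lt_mem_nhds hb] with u hu
    exact ell_eq_of_le hu.le
  rw [h.deriv_eq]; simp

/-- `ell' = 0` from `1` on (by continuity of `ell'` at `1`). [folklore] -/
theorem deriv_ell_of_ge {b : ℝ} (hb : 1 ≤ b) : deriv ell b = 0 := by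
  rcases hb.lt_or_eq with h | h
  · exact deriv_ell_of_gt h
  · subst h
    have hc : ContinuousAt (deriv ell) 1 := contDiff_deriv_ell.continuous.continuousAt
    have ht : Filter.Tendsto (deriv ell) (𝓝[>] (1 : ℝ)) (𝓝 (deriv ell 1)) :=
      hc.tendsto.mono_left nhdsWithin_le_nhds
    have ht0 : Filter.Tendsto (deriv ell) (𝓝[>] (1 : ℝ)) (𝓝 0) := by
      refine (tendsto_const_nhds (x := (0 : ℝ))).congr' ?_
      filter_upwards [self_mem_nhdsWithin] with u hu
      exact (deriv_ell_of_gt hu).symm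
    exact tendsto_nhds_unique ht ht0

/-- `ell'' = 0` beyond `1`. [folklore] -/
theorem deriv_deriv_ell_of_gt {b : ℝ} (hb : 1 < b) : deriv (deriv ell) b = 0 := by
  have h : deriv ell =ᶠ[𝓝 b] fun _ => (0 : ℝ) := by
    filter_upwards [lt_mem_nhds hb] with u hu
    exact deriv_ell_of_gt hu
  rw [h.deriv_eq]; simp

/-- `ell' ≥ 0` everywhere. [folklore] -/
theorem deriv_ell_nonneg (b : ℝ) : 0 ≤ deriv ell b := by
  rcases lt_or_ge b 1 with h | h
  · exact (deriv_ell_pos_of_lt h).le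
  · exact (deriv_ell_of_ge h).ge

/-- **The model potential** `Ψ = ‖w‖² + ε ‖x‖² + ε' ell (‖y‖²)` on `ℂ²`. [folklore] -/
def modelPsi (g : ℕ) (ε ε' : ℝ) (p : EuclideanSpace ℝ (Fin 4)) : ℝ :=
  ‖w g p‖ ^ 2 + ε * ‖cx p‖ ^ 2 + ε' * ell (‖cy p‖ ^ 2)

/-- `Ψ` is smooth. [folklore] -/
theorem contDiff_modelPsi (g : ℕ) (ε ε' : ℝ) : ContDiff ℝ ∞ (modelPsi g ε ε') :=
  ((contDiff_norm_sq_complex.comp (contDiff_w g)).add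
    (contDiff_const.mul (contDiff_norm_sq_complex.comp contDiff_cx))).add
    (contDiff_const.mul (contDiff_ell.comp (contDiff_norm_sq_complex.comp contDiff_cy)))

/-- `‖w‖² ≤ Ψ` when `ε, ε' ≥ 0`. [folklore] -/
theorem norm_sq_w_le_modelPsi {g : ℕ} {ε ε' : ℝ} (hε : 0 ≤ ε) (hε' : 0 ≤ ε') (p : EuclideanSpace ℝ (Fin 4)) :
    ‖w g p‖ ^ 2 ≤ modelPsi g ε ε' p := by
  have h1 : 0 ≤ ε * ‖cx p‖ ^ 2 := by positivity
  have h2 : 0 ≤ ε' * ell (‖cy p‖ ^ 2) := mul_nonneg hε' (ell_nonneg (by positivity))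
  simp only [modelPsi]; linarith

/-- `ε ‖x‖² ≤ Ψ` when `ε' ≥ 0`. [folklore] -/
theorem mul_norm_sq_cx_le_modelPsi {g : ℕ} (ε : ℝ) {ε' : ℝ} (hε' : 0 ≤ ε') (p : EuclideanSpace ℝ (Fin 4)) :
    ε * ‖cx p‖ ^ 2 ≤ modelPsi g ε ε' p := by
  have h1 : 0 ≤ ‖w g p‖ ^ 2 := by positivity
  have h2 : 0 ≤ ε' * ell (‖cy p‖ ^ 2) := mul_nonneg hε' (ell_nonneg (by positivity))
  simp only [modelPsi]; linarith

/-- **The derivative of `Ψ`** as a real-linear functional: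
`DΨ_p = 2 Re(w̄ Dw) + 2ε Re(x̄ dx) + 2ε' ell'(‖y‖²) Re(ȳ dy)`. [folklore] -/
def modelPsiD (g : ℕ) (ε ε' : ℝ) (p : EuclideanSpace ℝ (Fin 4)) : EuclideanSpace ℝ (Fin 4) →L[ℝ] ℝ :=
  (2 : ℝ) • reMul (conj (w g p)) (wD g p) + (2 * ε) • reMul (conj (cx p)) cxL +
    (2 * ε' * deriv ell (‖cy p‖ ^ 2)) • reMul (conj (cy p)) cyL

/-- Unfolding `modelPsiD`. [folklore] -/
theorem modelPsiD_apply (g : ℕ) (ε ε' : ℝ) (p v : EuclideanSpace ℝ (Fin 4)) :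
    modelPsiD g ε ε' p v = 2 * (conj (w g p) * wD g p v).re + 2 * ε * (conj (cx p) * cx v).re +
      2 * ε' * deriv ell (‖cy p‖ ^ 2) * (conj (cy p) * cy v).re := by
  simp [modelPsiD, smul_eq_mul]

/-- **`Ψ` has derivative `modelPsiD` at every point.** [folklore] -/
theorem hasFDerivAt_modelPsi (g : ℕ) (ε ε' : ℝ) (p : EuclideanSpace ℝ (Fin 4)) :
    HasFDerivAt (modelPsi g ε ε') (modelPsiD g ε ε' p) p := by
  have h1 := hasFDerivAt_norm_sq_w g p
  have h2 := (hasFDerivAt_norm_sq_cx p).const_mul ε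
  have hell : HasDerivAt ell (deriv ell (‖cy p‖ ^ 2)) (‖cy p‖ ^ 2) :=
    (differentiable_ell _).hasDerivAt
  have h3 := (hell.comp_hasFDerivAt p (hasFDerivAt_norm_sq_cy p)).const_mul ε'
  have h := (h1.add h2).add h3
  refine h.congr_fderiv ?_
  ext v
  simp [modelPsiD, smul_eq_mul]
  ring

/-- `fderiv` of `Ψ`. [folklore] -/
theorem fderiv_modelPsi (g : ℕ) (ε ε' : ℝ) (p : EuclideanSpace ℝ (Fin 4)) :
    fderiv ℝ (modelPsi g ε ε') p = modelPsiD g ε ε' p :=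
  (hasFDerivAt_modelPsi g ε ε' p).fderiv

/-- `Ψ` is differentiable. [folklore] -/
theorem differentiable_modelPsi (g : ℕ) (ε ε' : ℝ) : Differentiable ℝ (modelPsi g ε ε') :=
  fun p => (hasFDerivAt_modelPsi g ε ε' p).differentiableAt

/-! #### The second derivative and the flat Levi form of `Ψ` -/

/-- `deriv ell ∘ ‖y‖²` composed: the chain rule at `p`. [folklore] -/
theorem hasFDerivAt_deriv_ell_comp (p : EuclideanSpace ℝ (Fin 4)) :
    HasFDerivAt (fun q => deriv ell (‖cy q‖ ^ 2))
      (deriv (deriv ell) (‖cy p‖ ^ 2) • ((2 : ℝ) • reMul (conj (cy p)) cyL)) p := by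
  have hd : HasDerivAt (deriv ell) (deriv (deriv ell) (‖cy p‖ ^ 2)) (‖cy p‖ ^ 2) :=
    (differentiable_deriv_ell _).hasDerivAt
  exact hd.comp_hasFDerivAt p (hasFDerivAt_norm_sq_cy p)

/-- The second derivative of `Ψ` through the evaluation trick
`D²Ψ_p(a, b) = D(q ↦ DΨ_q(b))_p(a)`. [folklore] -/
theorem fderiv_fderiv_modelPsi_eq (g : ℕ) (ε ε' : ℝ) (p a b : EuclideanSpace ℝ (Fin 4)) :
    fderiv ℝ (fderiv ℝ (modelPsi g ε ε')) p a b =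
      fderiv ℝ (fun q => fderiv ℝ (modelPsi g ε ε') q b) p a := by
  have hΨ := contDiff_modelPsi g ε ε'
  have hc : DifferentiableAt ℝ (fderiv ℝ (modelPsi g ε ε')) p :=
    ((hΨ.fderiv_right (m := ∞) le_rfl).differentiable (by simp)) p
  rw [fderiv_clm_apply hc (differentiableAt_const b)]
  simp

/-- **The second derivative of `Ψ`, evaluated**:
`D²Ψ_p(a,b) = 2Re(conj(Dw a) Dw b) + 2Re(w̄ D²w(a,b)) + 2εRe(conj(x a) x b)
  + 2ε'[2 ell''(‖y‖²) Re(ȳ y a) Re(ȳ y b) + ell'(‖y‖²) Re(conj(y a) y b)]`. [folklore] -/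
theorem fderiv_fderiv_modelPsi_apply (g : ℕ) (ε ε' : ℝ) (p a b : EuclideanSpace ℝ (Fin 4)) :
    fderiv ℝ (fderiv ℝ (modelPsi g ε ε')) p a b =
      2 * (conj (wD g p a) * wD g p b).re + 2 * (conj (w g p) * wDD g p a b).re +
        2 * ε * (conj (cx a) * cx b).re +
        2 * ε' * (2 * deriv (deriv ell) (‖cy p‖ ^ 2) * (conj (cy p) * cy a).re * (conj (cy p) * cy b).re +
          deriv ell (‖cy p‖ ^ 2) * (conj (cy a) * cy b).re) := by
  rw [fderiv_fderiv_modelPsi_eq]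
  -- the evaluated first derivative, as an explicit function of the base point
  have hfun : (fun q => fderiv ℝ (modelPsi g ε ε') q b) = fun q =>
      2 * inner ℝ (w g q) (wD g q b) + 2 * ε * reMul (conj (cx b)) cxL q +
        2 * ε' * (deriv ell (‖cy q‖ ^ 2) * reMul (conj (cy b)) cyL q) := by
    funext q
    rw [fderiv_modelPsi, modelPsiD_apply]
    simp only [reMul_apply, cxL_apply, cyL_apply, Complex.inner, Complex.mul_re, Complex.conj_re,
      Complex.conj_im]
    ring
  rw [hfun]
  have h1 := ((hasFDerivAt_w g p).inner ℝ (hasFDerivAt_wD_apply g p b)).const_mul (2 : ℝ)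
  have h2 := ((reMul (conj (cx b)) cxL).hasFDerivAt (x := p)).const_mul (2 * ε)
  have h3 := ((hasFDerivAt_deriv_ell_comp p).mul
    ((reMul (conj (cy b)) cyL).hasFDerivAt (x := p))).const_mul (2 * ε')
  have h : HasFDerivAt (fun q => 2 * inner ℝ (w g q) (wD g q b) + 2 * ε * reMul (conj (cx b)) cxL q +
      2 * ε' * (deriv ell (‖cy q‖ ^ 2) * reMul (conj (cy b)) cyL q)) _ p := (h1.add h2).add h3
  rw [h.fderiv]
  simp only [add_apply, smul_apply, ContinuousLinearMap.comp_apply,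
    ContinuousLinearMap.prod_apply, fderivInnerCLM_apply, reMul_apply, cxL_apply, cyL_apply, wD_apply,
    Complex.inner, smul_eq_mul, FunLike.coe_smul, Pi.smul_apply,
    FunLike.coe_sub, Pi.sub_apply, Complex.mul_re, Complex.mul_im, Complex.conj_re,
    Complex.conj_im, Complex.sub_re, Complex.sub_im, wDD]
  ring

/-- **The flat Levi form of the model potential**:
`D²Ψ(u,u) + D²Ψ(J₀u,J₀u) = 4‖Dw u‖² + 4ε‖x(u)‖² + 4ε'(ell'(b) + b ell''(b))‖y(u)‖²`, `b = ‖y‖²`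
(the terms `Re(w̄ D²w)` cancel by `D²w(J₀u, J₀u) = -D²w(u, u)`). [cite: CieliebakEliashberg2012, §2.2] -/
theorem levi_modelPsi (g : ℕ) (ε ε' : ℝ) (p u : EuclideanSpace ℝ (Fin 4)) :
    fderiv ℝ (fderiv ℝ (modelPsi g ε ε')) p u u +
        fderiv ℝ (fderiv ℝ (modelPsi g ε ε')) p (stdComplexStructure u) (stdComplexStructure u) =
      4 * ‖wD g p u‖ ^ 2 + 4 * ε * ‖cx u‖ ^ 2 +
        4 * ε' * (deriv ell (‖cy p‖ ^ 2) + ‖cy p‖ ^ 2 * deriv (deriv ell) (‖cy p‖ ^ 2)) * ‖cy u‖ ^ 2 := by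
  rw [fderiv_fderiv_modelPsi_apply, fderiv_fderiv_modelPsi_apply, wD_J, wDD_J, cx_J, cy_J]
  simp only [Complex.sq_norm, Complex.normSq_apply, Complex.mul_re, Complex.mul_im, Complex.conj_re,
    Complex.conj_im, Complex.I_re, Complex.I_im, Complex.neg_re, Complex.neg_im, map_mul,
    Complex.conj_I]
  ring

/-! ### §3 Strict plurisubharmonicity of the model potential -/

/-- The derivative of `u ↦ -(1-u)⁻¹` below `1`. [folklore] -/
theorem hasDerivAt_neg_inv_one_sub {b : ℝ} (hb : b < 1) :
    HasDerivAt (fun u : ℝ => -(1 - u)⁻¹) (-((1 - b)⁻¹ ^ 2)) b := by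
  have hne : 1 - b ≠ 0 := (sub_pos.2 hb).ne'
  have h0 : HasDerivAt (fun u : ℝ => -(1 - u)⁻¹) (-(-(0 - 1) / (1 - b) ^ 2)) b :=
    (((hasDerivAt_const b (1 : ℝ)).sub (hasDerivAt_id' b)).inv hne).neg
  have he : -(-(0 - 1) / (1 - b) ^ 2) = -((1 - b)⁻¹ ^ 2) := by
    rw [inv_pow]; ring
  rwa [he] at h0

/-- **The second derivative of `ell` below `1`**: `ell'' b = e^{-1/(1-b)} (2(1-b)⁻³ - (1-b)⁻⁴)`.
[folklore] -/
theorem hasDerivAt_deriv_ell_of_lt {b : ℝ} (hb : b < 1) :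
    HasDerivAt (deriv ell) (Real.exp (-(1 - b)⁻¹) * (2 * (1 - b)⁻¹ ^ 3 - (1 - b)⁻¹ ^ 4)) b := by
  have hf := hasDerivAt_neg_inv_one_sub hb
  have hF : HasDerivAt (fun u : ℝ => Real.exp (-(1 - u)⁻¹) * (-(1 - u)⁻¹) ^ 2)
      (Real.exp (-(1 - b)⁻¹) * -((1 - b)⁻¹ ^ 2) * (-(1 - b)⁻¹) ^ 2 +
        Real.exp (-(1 - b)⁻¹) * (↑(2 : ℕ) * (-(1 - b)⁻¹) ^ (2 - 1) * -((1 - b)⁻¹ ^ 2))) b :=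
    hf.exp.mul (hf.pow 2)
  have heq : deriv ell =ᶠ[𝓝 b] fun u => Real.exp (-(1 - u)⁻¹) * (-(1 - u)⁻¹) ^ 2 := by
    filter_upwards [gt_mem_nhds hb] with u hu
    rw [deriv_ell_of_lt hu]; ring
  refine (hF.congr_of_eventuallyEq heq).congr_deriv ?_
  push_cast
  ring

/-- `deriv (deriv ell)` below `1`. [folklore] -/
theorem deriv_deriv_ell_of_lt {b : ℝ} (hb : b < 1) :
    deriv (deriv ell) b = Real.exp (-(1 - b)⁻¹) * (2 * (1 - b)⁻¹ ^ 3 - (1 - b)⁻¹ ^ 4) :=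
  (hasDerivAt_deriv_ell_of_lt hb).deriv

/-- `ell'' = 0` from `1` on (by continuity at `1`). [folklore] -/
theorem deriv_deriv_ell_of_ge {b : ℝ} (hb : 1 ≤ b) : deriv (deriv ell) b = 0 := by
  rcases hb.lt_or_eq with h | h
  · exact deriv_deriv_ell_of_gt h
  · subst h
    have hc : ContinuousAt (deriv (deriv ell)) 1 :=
      (contDiff_ell.iterate_deriv 2).continuous.continuousAt
    have ht : Filter.Tendsto (deriv (deriv ell)) (𝓝[>] (1 : ℝ)) (𝓝 (deriv (deriv ell) 1)) :=
      hc.tendsto.mono_left nhdsWithin_le_nhds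
    have ht0 : Filter.Tendsto (deriv (deriv ell)) (𝓝[>] (1 : ℝ)) (𝓝 0) := by
      refine (tendsto_const_nhds (x := (0 : ℝ))).congr' ?_
      filter_upwards [self_mem_nhdsWithin] with u hu
      exact (deriv_deriv_ell_of_gt hu).symm
    exact tendsto_nhds_unique ht ht0

/-- **The Levi coefficient of the cut-off term**, `ell'(b) + b ell''(b)`. [folklore] -/
def ellL (b : ℝ) : ℝ := deriv ell b + b * deriv (deriv ell) b

/-- `ellL = 0` from `1` on. [folklore] -/
theorem ellL_of_ge {b : ℝ} (hb : 1 ≤ b) : ellL b = 0 := by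
  simp [ellL, deriv_ell_of_ge hb, deriv_deriv_ell_of_ge hb]

/-- `ellL 0 = e⁻¹ > 0`. [folklore] -/
theorem ellL_zero : ellL 0 = Real.exp (-1) := by
  simp [ellL, deriv_ell_zero]

/-- `ellL` below `1`, in closed form: `e^{-1/v} v⁻⁴ (-v² + 3v - 1)`, `v = 1 - b`. [folklore] -/
theorem ellL_eq_of_lt {b : ℝ} (hb : b < 1) :
    ellL b = Real.exp (-(1 - b)⁻¹) * (1 - b)⁻¹ ^ 4 * (-(1 - b) ^ 2 + 3 * (1 - b) - 1) := by
  have hne : 1 - b ≠ 0 := (sub_pos.2 hb).ne'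
  rw [ellL, deriv_ell_of_lt hb, deriv_deriv_ell_of_lt hb]
  field_simp
  ring

/-- **`|ellL| ≤ 120` on `b ≥ 0`.** [folklore] -/
theorem abs_ellL_le {b : ℝ} (hb : 0 ≤ b) : |ellL b| ≤ 120 := by
  rcases lt_or_ge b 1 with h | h
  · rw [ellL_eq_of_lt h]
    set v : ℝ := 1 - b with hv
    have hv0 : 0 < v := sub_pos.2 h
    have hv1 : v ≤ 1 := by rw [hv]; linarith
    -- `t⁴ e^{-t} ≤ 24` for `t = v⁻¹ ≥ 0`, from `t⁴/4! ≤ e^t`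
    have ht : v⁻¹ ^ 4 * Real.exp (-v⁻¹) ≤ 24 := by
      have h := Real.pow_div_factorial_le_exp (hx := (inv_pos.2 hv0).le) (n := 4)
      have h4 : ((4 : ℕ).factorial : ℝ) = 24 := by norm_num [Nat.factorial]
      rw [h4, div_le_iff₀ (by norm_num : (0 : ℝ) < 24)] at h
      rw [Real.exp_neg, mul_inv_le_iff₀ (Real.exp_pos _)]
      linarith
    have hq : |(-v ^ 2 + 3 * v - 1)| ≤ 5 := by
      rw [abs_le]; constructor <;> nlinarith
    rw [abs_mul, abs_mul, abs_of_pos (Real.exp_pos _), abs_of_nonneg (by positivity : (0 : ℝ) ≤ v⁻¹ ^ 4)]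
    have hE : Real.exp (-v⁻¹) * v⁻¹ ^ 4 ≤ 24 := by rw [mul_comm]; exact ht
    calc Real.exp (-v⁻¹) * v⁻¹ ^ 4 * |(-v ^ 2 + 3 * v - 1)|
        ≤ 24 * 5 := mul_le_mul hE hq (abs_nonneg _) (by norm_num)
      _ = 120 := by norm_num
  · rw [ellL_of_ge h]; norm_num

/-- **Where the cut-off's Levi coefficient is negative, `1/2 < ‖y‖² < 1`.** [folklore] -/
theorem lt_of_ellL_neg {b : ℝ} (hb : 0 ≤ b) (hL : ellL b < 0) : 1 / 2 < b ∧ b < 1 := by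
  have h1 : b < 1 := by
    by_contra h
    rw [ellL_of_ge (not_lt.1 h)] at hL
    exact lt_irrefl _ hL
  refine ⟨?_, h1⟩
  rw [ellL_eq_of_lt h1] at hL
  set v : ℝ := 1 - b with hv
  have hv0 : 0 < v := sub_pos.2 h1
  have hpos : 0 < Real.exp (-v⁻¹) * v⁻¹ ^ 4 := by positivity
  have hq : -v ^ 2 + 3 * v - 1 < 0 := by
    by_contra h
    exact (not_le.2 hL) (mul_nonneg hpos.le (not_lt.1 h))
  by_contra hb2
  have hvle : v ≤ 1 := by rw [hv]; linarith
  have hvge : 1 / 2 ≤ v := by rw [hv]; linarith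
  nlinarith

/-- A vector of `ℝ⁴` with both complex coordinates zero is zero. [folklore] -/
theorem eq_zero_of_cx_cy {u : EuclideanSpace ℝ (Fin 4)} (hx : cx u = 0) (hy : cy u = 0) : u = 0 := by
  rw [← mk_cx_cy u, hx, hy]
  ext i; fin_cases i <;> simp [mk]

/-- On `{‖w‖ ≤ 1}`, where the cut-off acts (`‖y‖² < 1`) one has `‖x‖^{2g+1} ≤ 3`, hence
`‖x‖^{4g} ≤ 9`. [folklore] -/
theorem norm_cx_pow_le {g : ℕ} {p : EuclideanSpace ℝ (Fin 4)} (hw : ‖w g p‖ ≤ 1) (hy : ‖cy p‖ ^ 2 < 1) :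
    ‖cx p‖ ^ (4 * g) ≤ 9 := by
  have hx3 : ‖cx p‖ ^ (2 * g + 1) ≤ 3 := by
    have he : cx p ^ (2 * g + 1) = cy p ^ 2 - 1 - w g p := by
      simp only [w, Phi]; ring
    have := norm_sub_le (cy p ^ 2 - 1) (w g p)
    have h2 := norm_sub_le (cy p ^ 2) (1 : ℂ)
    rw [← norm_pow, he]
    rw [norm_pow] at h2
    simp only [norm_one] at h2
    linarith
  rcases le_or_gt ‖cx p‖ 1 with h1 | h1
  · calc ‖cx p‖ ^ (4 * g) ≤ 1 := pow_le_one₀ (norm_nonneg _) h1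
      _ ≤ 9 := by norm_num
  · have hmono : ‖cx p‖ ^ (4 * g) ≤ ‖cx p‖ ^ (4 * g + 2) :=
      pow_le_pow_right₀ h1.le (by omega)
    have hsq : ‖cx p‖ ^ (4 * g + 2) = (‖cx p‖ ^ (2 * g + 1)) ^ 2 := by
      rw [← pow_mul]; ring_nf
    rw [hsq] at hmono
    have h0 : 0 ≤ ‖cx p‖ ^ (2 * g + 1) := by positivity
    have h9 : (‖cx p‖ ^ (2 * g + 1)) ^ 2 ≤ 9 := by nlinarith
    linarith

/-- **Strict plurisubharmonicity of the model potential on `{‖w‖ ≤ 1}`**: for `0 < ε ≤ 1` and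
`0 < ε'` with `5000 (2g+1)² ε' ≤ ε`, the flat Levi form of `Ψ = ‖w‖² + ε‖x‖² + ε' ell(‖y‖²)` is
positive definite at every point with `‖w‖ ≤ 1`.  Off the zone where the cut-off's Levi
coefficient is negative the three terms are non-negative and cannot all vanish on `u ≠ 0`
(`Dw u = 0 = x(u)` forces `y · y(u) = 0`, and at `y = 0` the cut-off term `4ε' e⁻¹ ‖y(u)‖²` is
positive); on that zone `‖y‖² > 1/2`, `‖x‖^{4g} ≤ 9` and
`4‖2y y(u) - (2g+1)x^{2g} x(u)‖² + 4ε‖x(u)‖²` dominates `480 ε' ‖y(u)‖²`.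
[cite: CieliebakEliashberg2012, §2.2] -/
theorem levi_modelPsi_pos {g : ℕ} {ε ε' : ℝ} (hε : 0 < ε) (hε1 : ε ≤ 1) (hε' : 0 < ε')
    (hε'le : ε' * (5000 * (2 * g + 1) ^ 2) ≤ ε) {p : EuclideanSpace ℝ (Fin 4)} (hw : ‖w g p‖ ≤ 1)
    {u : EuclideanSpace ℝ (Fin 4)} (hu : u ≠ 0) :
    0 < fderiv ℝ (fderiv ℝ (modelPsi g ε ε')) p u u +
      fderiv ℝ (fderiv ℝ (modelPsi g ε ε')) p (stdComplexStructure u) (stdComplexStructure u) := by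
  rw [levi_modelPsi]
  have hLdef : deriv ell (‖cy p‖ ^ 2) + ‖cy p‖ ^ 2 * deriv (deriv ell) (‖cy p‖ ^ 2) = ellL (‖cy p‖ ^ 2) := rfl
  rw [hLdef]
  set b : ℝ := ‖cy p‖ ^ 2 with hb
  set A : ℝ := ‖wD g p u‖ ^ 2 with hA
  set X : ℝ := ‖cx u‖ ^ 2 with hX
  set Y : ℝ := ‖cy u‖ ^ 2 with hY
  have hb0 : 0 ≤ b := by positivity
  have hA0 : 0 ≤ A := by positivity
  have hX0 : 0 ≤ X := by positivity
  have hY0 : 0 ≤ Y := by positivity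
  have hε'1 : ε' * 5000 ≤ ε := by
    have h1 : (1 : ℝ) ≤ (2 * g + 1) ^ 2 := by
      have : (1 : ℝ) ≤ 2 * g + 1 := by
        have := Nat.cast_nonneg (α := ℝ) g; linarith
      nlinarith
    nlinarith
  -- not both complex coordinates of `u` vanish
  have hXY : 0 < X ∨ 0 < Y := by
    by_contra h
    push Not at h
    have hx0 : cx u = 0 := by
      have : ‖cx u‖ ^ 2 = 0 := le_antisymm (by rw [← hX]; exact h.1) (by positivity)
      exact norm_eq_zero.1 (pow_eq_zero_iff (by norm_num) |>.1 this)
    have hy0 : cy u = 0 := by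
      have : ‖cy u‖ ^ 2 = 0 := le_antisymm (by rw [← hY]; exact h.2) (by positivity)
      exact norm_eq_zero.1 (pow_eq_zero_iff (by norm_num) |>.1 this)
    exact hu (eq_zero_of_cx_cy hx0 hy0)
  have hεXY : 0 < ε * X ∨ 0 < Y := hXY.imp (fun h => mul_pos hε h) id
  have hεX0 : 0 ≤ ε * X := by positivity
  rcases le_or_gt 0 (ellL b) with hL | hL
  · -- the cut-off term is non-negative
    have h3 : 0 ≤ 4 * ε' * ellL b * Y := by positivity
    rcases hXY with hXp | hYp
    · have : 0 < ε * X := mul_pos hε hXp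
      linarith
    · -- `Y > 0`; if `X > 0` we are done, else `x(u) = 0` and `A = 4 b Y`
      rcases lt_or_ge 0 X with hXp | hXle
      · have : 0 < ε * X := mul_pos hε hXp
        linarith
      · have hX0' : X = 0 := le_antisymm hXle hX0
        have hεX : ε * X = 0 := by rw [hX0', mul_zero]
        have hxu : cx u = 0 := by
          have : ‖cx u‖ ^ 2 = 0 := by rw [← hX]; exact hX0'
          exact norm_eq_zero.1 (pow_eq_zero_iff (by norm_num) |>.1 this)
        have hAeq : A = 4 * b * Y := by
          rw [hA, hb, hY, wD_apply, hxu, mul_zero, sub_zero, norm_mul, norm_mul, mul_pow, mul_pow]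
          norm_num
        rcases lt_or_ge 0 b with hbp | hble
        · have hbY : 0 < b * Y := mul_pos hbp hYp
          linarith
        · have hb00 : b = 0 := le_antisymm hble hb0
          have hLe : ellL b = Real.exp (-1) := by rw [hb00, ellL_zero]
          have : 0 < 4 * ε' * ellL b * Y := by rw [hLe]; positivity
          linarith
  · -- the cut-off's Levi coefficient is negative: `1/2 < b < 1`, `|ellL| ≤ 120`
    obtain ⟨hb1, hb2⟩ := lt_of_ellL_neg hb0 hL
    have hLge : -120 ≤ ellL b := (abs_le.1 (abs_ellL_le hb0)).1
    have hx9 : ‖cx p‖ ^ (4 * g) ≤ 9 := norm_cx_pow_le hw (by rw [← hb]; exact hb2)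
    have hcut : -(480 * ε' * Y) ≤ 4 * ε' * ellL b * Y :=
      calc -(480 * ε' * Y) = (4 * ε' * Y) * (-120) := by ring
        _ ≤ (4 * ε' * Y) * ellL b := mul_le_mul_of_nonneg_left hLge (by positivity)
        _ = 4 * ε' * ellL b * Y := by ring
    have hε'Y : 480 * ε' * Y ≤ Y := by nlinarith
    -- `P = 2 y y(u)`, `Q = (2g+1) x^{2g} x(u)`, `A = ‖P - Q‖²`, `‖P‖² = 4 b Y`, `‖Q‖² = K X`
    set P : ℂ := 2 * cy p * cy u with hP
    set Q : ℂ := ((2 * g + 1 : ℕ) : ℂ) * cx p ^ (2 * g) * cx u with hQ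
    have hAPQ : A = ‖P - Q‖ ^ 2 := by rw [hA, wD_apply]
    have hP2 : ‖P‖ ^ 2 = 4 * b * Y := by
      rw [hP, hb, hY, norm_mul, norm_mul, mul_pow, mul_pow]; norm_num
    set K : ℝ := ((2 * g + 1 : ℕ) : ℝ) ^ 2 * (‖cx p‖ ^ (2 * g)) ^ 2 with hK
    have hQ2 : ‖Q‖ ^ 2 = K * X := by
      rw [hQ, hK, hX, norm_mul, norm_mul, norm_pow, mul_pow, mul_pow, Complex.norm_natCast]
    have hK9 : K ≤ ((2 * g + 1 : ℕ) : ℝ) ^ 2 * 9 := by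
      rw [hK, ← pow_mul, show 2 * g * 2 = 4 * g by ring]
      exact mul_le_mul_of_nonneg_left hx9 (by positivity)
    have hP4 : (‖P‖ / 2) ^ 2 = b * Y := by rw [div_pow, hP2]; ring
    -- two sub-cases according to `‖Q‖ ≤ ‖P‖/2`
    rcases le_or_gt ‖Q‖ (‖P‖ / 2) with hsmall | hlarge
    · -- `A ≥ (‖P‖ - ‖Q‖)² ≥ ‖P‖²/4 = b Y ≥ Y/2`
      have hA1 : ‖P‖ / 2 ≤ ‖P - Q‖ := by linarith [norm_sub_norm_le P Q]
      have hA2 : b * Y ≤ A := by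
        have h := pow_le_pow_left₀ (by positivity : 0 ≤ ‖P‖ / 2) hA1 2
        rw [hAPQ, ← hP4]; exact h
      have h5 : Y ≤ 2 * (b * Y) := by nlinarith
      rcases hεXY with hXp | hYp
      · linarith
      · linarith
    · -- `‖Q‖ > ‖P‖/2`: `K X = ‖Q‖² > ‖P‖²/4 = b Y ≥ Y/2`, and `ε ≥ 5000 (2g+1)² ε'`
      have hKX : b * Y < K * X := by
        rw [← hQ2, ← hP4]
        exact pow_lt_pow_left₀ hlarge (by positivity) two_ne_zero
      have h1 : Y ≤ 2 * (K * X) := by nlinarith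
      have hn : ((2 * g + 1 : ℕ) : ℝ) ^ 2 = (2 * (g : ℝ) + 1) ^ 2 := by push_cast; ring
      have h2 : ε' * K ≤ ε * (9 / 5000) :=
        calc ε' * K ≤ ε' * (((2 * g + 1 : ℕ) : ℝ) ^ 2 * 9) := mul_le_mul_of_nonneg_left hK9 hε'.le
          _ = ε' * (5000 * (2 * (g : ℝ) + 1) ^ 2) * (9 / 5000) := by rw [hn]; ring
          _ ≤ ε * (9 / 5000) := mul_le_mul_of_nonneg_right hε'le (by norm_num)
      have h3 : 480 * ε' * Y ≤ 960 * (ε' * K) * X :=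
        calc 480 * ε' * Y ≤ 480 * ε' * (2 * (K * X)) := mul_le_mul_of_nonneg_left h1 (by positivity)
          _ = 960 * (ε' * K) * X := by ring
      have h4 : 960 * (ε' * K) * X ≤ 960 * (ε * (9 / 5000)) * X :=
        mul_le_mul_of_nonneg_right (mul_le_mul_of_nonneg_left h2 (by norm_num)) hX0
      have hXpos : 0 < X := by
        rcases lt_or_ge 0 X with h | h
        · exact h
        · have hX00 : X = 0 := le_antisymm h hX0
          rw [hX00, mul_zero] at hKX
          have : 0 ≤ b * Y := by positivity
          linarith
      have hεX : 0 < ε * X := mul_pos hε hXpos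
      linarith

/-! ### §4 The radial and the fibre vector fields; `1/4` is a regular value; compactness -/

/-- The `dx`-coefficient of `Dw`: `wxC g p = (2g+1) x^{2g}`, so that
`Dw(v) = 2y · y(v) - wxC · x(v)`. [folklore] -/
def wxC (g : ℕ) (p : EuclideanSpace ℝ (Fin 4)) : ℂ := ((2 * g + 1 : ℕ) : ℂ) * cx p ^ (2 * g)

/-- `Dw` through `wxC`. [folklore] -/
theorem wD_apply' (g : ℕ) (p v : EuclideanSpace ℝ (Fin 4)) :
    wD g p v = 2 * cy p * cy v - wxC g p * cx v := by
  simp [wD_apply, wxC]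

/-- **The radial field** `radV = w · (−conj wxC, conj (2y))` (the Euclidean-dual lift of the
radial vector field `w ∂_w` of the `w`-plane): `Dw(radV) = w (‖wxC‖² + ‖2y‖²)` is a POSITIVE REAL
multiple of `w`, so the flow of any real multiple of `radV` preserves `arg w` and `{w = 0}`.
[folklore] -/
def radV (g : ℕ) (p : EuclideanSpace ℝ (Fin 4)) : EuclideanSpace ℝ (Fin 4) :=
  mk (-(w g p * conj (wxC g p))) (w g p * conj (2 * cy p))

/-- `x`-part of the radial field. [folklore] -/
@[simp] theorem cx_radV (g : ℕ) (p : EuclideanSpace ℝ (Fin 4)) : cx (radV g p) = -(w g p * conj (wxC g p)) := by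
  simp [radV]

/-- `y`-part of the radial field. [folklore] -/
@[simp] theorem cy_radV (g : ℕ) (p : EuclideanSpace ℝ (Fin 4)) : cy (radV g p) = w g p * conj (2 * cy p) := by
  simp [radV]

/-- **`Dw(radV) = w · (‖wxC‖² + ‖2y‖²)`.** [folklore] -/
theorem wD_radV (g : ℕ) (p : EuclideanSpace ℝ (Fin 4)) :
    wD g p (radV g p) = w g p * ((‖wxC g p‖ ^ 2 + ‖2 * cy p‖ ^ 2 : ℝ) : ℂ) := by
  rw [wD_apply', cx_radV, cy_radV]
  have h1 : (2 * cy p) * conj (2 * cy p) = ((‖2 * cy p‖ : ℂ)) ^ 2 := Complex.mul_conj' _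
  have h2 : wxC g p * conj (wxC g p) = ((‖wxC g p‖ : ℂ)) ^ 2 := Complex.mul_conj' _
  push_cast
  linear_combination (w g p) * h1 + (w g p) * h2

/-- **The fibre field** `fibV = x · (‖2y‖², conj(2y) · wxC)`: tangent to the fibres of `w`
(`Dw(fibV) = 0`), with `x`-part `x ‖2y‖²`. [folklore] -/
def fibV (g : ℕ) (p : EuclideanSpace ℝ (Fin 4)) : EuclideanSpace ℝ (Fin 4) :=
  mk (cx p * ((‖2 * cy p‖ ^ 2 : ℝ) : ℂ)) (cx p * conj (2 * cy p) * wxC g p)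

/-- `x`-part of the fibre field. [folklore] -/
@[simp] theorem cx_fibV (g : ℕ) (p : EuclideanSpace ℝ (Fin 4)) :
    cx (fibV g p) = cx p * ((‖2 * cy p‖ ^ 2 : ℝ) : ℂ) := by
  simp [fibV]

/-- `y`-part of the fibre field. [folklore] -/
@[simp] theorem cy_fibV (g : ℕ) (p : EuclideanSpace ℝ (Fin 4)) :
    cy (fibV g p) = cx p * conj (2 * cy p) * wxC g p := by
  simp [fibV]

/-- **`Dw(fibV) = 0`**: the fibre field is tangent to the pages `w = const`. [folklore] -/
theorem wD_fibV (g : ℕ) (p : EuclideanSpace ℝ (Fin 4)) : wD g p (fibV g p) = 0 := by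
  rw [wD_apply', cx_fibV, cy_fibV]
  have h1 : (2 * cy p) * conj (2 * cy p) = ((‖2 * cy p‖ : ℂ)) ^ 2 := Complex.mul_conj' _
  push_cast
  linear_combination (cx p * wxC g p) * h1

/-- `DΨ(radV) = 2‖w‖²(‖wxC‖² + ‖2y‖²) - 2ε Re(x̄ w conj wxC) + 2ε' ell'(‖y‖²) Re(ȳ w conj(2y))`.
[folklore] -/
theorem modelPsiD_radV (g : ℕ) (ε ε' : ℝ) (p : EuclideanSpace ℝ (Fin 4)) :
    modelPsiD g ε ε' p (radV g p) =
      2 * ‖w g p‖ ^ 2 * (‖wxC g p‖ ^ 2 + ‖2 * cy p‖ ^ 2) -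
        2 * ε * (conj (cx p) * (w g p * conj (wxC g p))).re +
        2 * ε' * deriv ell (‖cy p‖ ^ 2) * (conj (cy p) * (w g p * conj (2 * cy p))).re := by
  rw [modelPsiD_apply, wD_radV, cx_radV, cy_radV]
  have h1 : (conj (w g p) * (w g p * (((‖wxC g p‖ ^ 2 + ‖2 * cy p‖ ^ 2 : ℝ)) : ℂ))).re =
      ‖w g p‖ ^ 2 * (‖wxC g p‖ ^ 2 + ‖2 * cy p‖ ^ 2) := by
    rw [← mul_assoc, Complex.conj_mul', ← Complex.ofReal_pow, ← Complex.ofReal_mul, Complex.ofReal_re]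
  rw [h1, mul_neg, Complex.neg_re]
  ring

/-- `DΨ(fibV) = 2ε ‖x‖² ‖2y‖² + 2ε' ell'(‖y‖²) Re(ȳ x conj(2y) wxC)`. [folklore] -/
theorem modelPsiD_fibV (g : ℕ) (ε ε' : ℝ) (p : EuclideanSpace ℝ (Fin 4)) :
    modelPsiD g ε ε' p (fibV g p) =
      2 * ε * (‖cx p‖ ^ 2 * ‖2 * cy p‖ ^ 2) +
        2 * ε' * deriv ell (‖cy p‖ ^ 2) * (conj (cy p) * (cx p * conj (2 * cy p) * wxC g p)).re := by
  rw [modelPsiD_apply, wD_fibV, cx_fibV, cy_fibV]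
  have h1 : (conj (cx p) * (cx p * (((‖2 * cy p‖ ^ 2 : ℝ)) : ℂ))).re = ‖cx p‖ ^ 2 * ‖2 * cy p‖ ^ 2 := by
    rw [← mul_assoc, Complex.conj_mul', ← Complex.ofReal_pow, ← Complex.ofReal_mul, Complex.ofReal_re]
  rw [h1]
  simp

/-- `ell' ≤ 2` (from `t² e^{-t} ≤ 2`). [folklore] -/
theorem deriv_ell_le_two (b : ℝ) : deriv ell b ≤ 2 := by
  rcases lt_or_ge b 1 with h | h
  · rw [deriv_ell_of_lt h]
    set v : ℝ := 1 - b
    have hv0 : 0 < v := sub_pos.2 h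
    have ht : 0 ≤ v⁻¹ := (inv_pos.2 hv0).le
    have h2 := Real.pow_div_factorial_le_exp (hx := ht) (n := 2)
    have hf : ((2 : ℕ).factorial : ℝ) = 2 := by norm_num [Nat.factorial]
    rw [hf, div_le_iff₀ (by norm_num : (0 : ℝ) < 2)] at h2
    rw [Real.exp_neg, inv_mul_le_iff₀ (Real.exp_pos _)]
    linarith
  · rw [deriv_ell_of_ge h]; norm_num

/-- A vector space point is not critical if the derivative is non-zero on some vector.
[folklore] -/
theorem not_isMCriticalPt_of_fderiv_apply_ne {f : EuclideanSpace ℝ (Fin 4) → ℝ}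
    {p v : EuclideanSpace ℝ (Fin 4)} (h : fderiv ℝ f p v ≠ 0) : ¬ IsMCriticalPt (𝓡 4) f p := by
  simp only [IsMCriticalPt, mfderiv_eq_fderiv]
  intro h0
  apply h
  exact (congrArg (fun L : TangentSpace (𝓡 4) p →L[ℝ] TangentSpace 𝓘(ℝ, ℝ) (f p) => L v) h0).trans rfl

/-- On `{Ψ ≤ c}`: `‖w‖² ≤ c`, `ε‖x‖² ≤ c`. [folklore] -/
theorem bounds_of_modelPsi_le {g : ℕ} {ε ε' : ℝ} (hε : 0 ≤ ε) (hε' : 0 ≤ ε')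
    {p : EuclideanSpace ℝ (Fin 4)} {c : ℝ} (hp : modelPsi g ε ε' p ≤ c) :
    ‖w g p‖ ^ 2 ≤ c ∧ ε * ‖cx p‖ ^ 2 ≤ c :=
  ⟨(norm_sq_w_le_modelPsi hε hε' p).trans hp, (mul_norm_sq_cx_le_modelPsi ε hε' p).trans hp⟩

/-- `y² = w + 1 + x^{2g+1}`. [folklore] -/
theorem cy_sq_eq (g : ℕ) (p : EuclideanSpace ℝ (Fin 4)) : cy p ^ 2 = w g p + 1 + cx p ^ (2 * g + 1) := by
  simp only [w, Phi]; ring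

/-- **The regime `‖w‖² < 1/8` on the level `{Ψ = 1/4}` lies far out along the page**:
`‖x‖² > 8` and `‖y‖² > 1` (for `ε ≤ 1/80`, `ε' ≤ 1/50`). [folklore] -/
theorem far_of_norm_w_sq_lt {g : ℕ} {ε ε' : ℝ} (hε : 0 < ε) (hε80 : ε ≤ 1 / 80) (hε' : 0 ≤ ε')
    (hε'50 : ε' ≤ 1 / 50) {p : EuclideanSpace ℝ (Fin 4)} (hp : modelPsi g ε ε' p = 1 / 4)
    (hw : ‖w g p‖ ^ 2 < 1 / 8) : 8 < ‖cx p‖ ^ 2 ∧ 1 < ‖cy p‖ ^ 2 := by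
  have hell : ε' * ell (‖cy p‖ ^ 2) ≤ 1 / 50 := by
    have h1 := ell_le (‖cy p‖ ^ 2)
    have h2 : Real.exp (-1) ≤ 1 := by
      rw [Real.exp_neg]; exact inv_le_one_of_one_le₀ (Real.one_le_exp zero_le_one)
    have h3 : 0 ≤ ell (‖cy p‖ ^ 2) := ell_nonneg (by positivity)
    nlinarith
  have hx : 8 < ‖cx p‖ ^ 2 := by
    have h1 : 1 / 10 < ε * ‖cx p‖ ^ 2 := by simp only [modelPsi] at hp; linarith
    by_contra h
    push Not at h
    have : ε * ‖cx p‖ ^ 2 ≤ (1 / 80) * 8 := by nlinarith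
    linarith
  refine ⟨hx, ?_⟩
  -- `‖y‖² = ‖w + 1 + x^{2g+1}‖ ≥ ‖x‖^{2g+1} - 1 - ‖w‖ ≥ ‖x‖ - 3/2 > 1`
  have hx1 : 14 / 5 < ‖cx p‖ := by nlinarith [norm_nonneg (cx p)]
  have hxpow : ‖cx p‖ ≤ ‖cx p‖ ^ (2 * g + 1) := by
    calc ‖cx p‖ = ‖cx p‖ ^ 1 := (pow_one _).symm
      _ ≤ ‖cx p‖ ^ (2 * g + 1) := pow_le_pow_right₀ (by linarith) (by omega)
  have hwn : ‖w g p‖ < 1 / 2 := by nlinarith [norm_nonneg (w g p)]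
  have hy : ‖cx p‖ ^ (2 * g + 1) - 1 - ‖w g p‖ ≤ ‖cy p‖ ^ 2 := by
    rw [← norm_pow (cy p) 2, cy_sq_eq g p]
    have h1 : ‖cx p ^ (2 * g + 1)‖ - ‖w g p + 1‖ ≤ ‖w g p + 1 + cx p ^ (2 * g + 1)‖ := by
      have := norm_sub_norm_le (cx p ^ (2 * g + 1)) (-(w g p + 1))
      rwa [norm_neg, sub_neg_eq_add, add_comm (cx p ^ (2 * g + 1))] at this
    have h2 : ‖w g p + 1‖ ≤ ‖w g p‖ + 1 := (norm_add_le _ _).trans (by simp)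
    rw [norm_pow] at h1
    linarith
  linarith
set_option maxHeartbeats 400000 in -- buildfix (bf3-g27): 160k/180k FAIL, 200k PASS at accept time; line-neutral budget line
/-- **`1/4` is a regular value of the model potential** (for `0 < ε ≤ 1/80`,
`0 < ε' ≤ ε/5000`): where `‖w‖² ≥ 1/8` the radial field gives `DΨ(radV) > 0`; where
`‖w‖² < 1/8` the point is far out along the page (`‖x‖² > 8`, `‖y‖² > 1`, so the cut-off is
saturated) and the fibre field gives `DΨ(fibV) = 8ε‖x‖²‖y‖² > 0`. [folklore] -/
theorem modelPsiD_ne_zero {g : ℕ} {ε ε' : ℝ} (hε : 0 < ε) (hε80 : ε ≤ 1 / 80) (hε' : 0 < ε')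
    (hε'le : ε' * 5000 ≤ ε) {p : EuclideanSpace ℝ (Fin 4)} (hp : modelPsi g ε ε' p = 1 / 4) :
    modelPsiD g ε ε' p ≠ 0 := by
  have hε'50 : ε' ≤ 1 / 50 := by linarith
  obtain ⟨hw4, hx4⟩ := bounds_of_modelPsi_le hε.le hε'.le hp.le
  rcases lt_or_ge (‖w g p‖ ^ 2) (1 / 8) with hw | hw
  · -- far regime: the fibre field
    obtain ⟨hx8, hy1⟩ := far_of_norm_w_sq_lt hε hε80 hε'.le hε'50 hp hw
    intro h0
    have h1 : modelPsiD g ε ε' p (fibV g p) = 0 := by rw [h0]; rfl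
    rw [modelPsiD_fibV, deriv_ell_of_ge hy1.le] at h1
    simp only [mul_zero, zero_mul, add_zero] at h1
    have hxp : 0 < ‖cx p‖ ^ 2 := by linarith
    have hyp : 0 < ‖2 * cy p‖ ^ 2 := by rw [norm_mul, mul_pow]; norm_num; linarith
    have : 0 < 2 * ε * (‖cx p‖ ^ 2 * ‖2 * cy p‖ ^ 2) := by positivity
    linarith
  · -- near regime: the radial field
    intro h0
    have h1 : modelPsiD g ε ε' p (radV g p) = 0 := by rw [h0]; rfl
    rw [modelPsiD_radV] at h1
    set N : ℝ := ‖wxC g p‖ ^ 2 + ‖2 * cy p‖ ^ 2 with hN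
    -- the two perturbation terms
    have hA : |(conj (cx p) * (w g p * conj (wxC g p))).re| ≤ ‖cx p‖ * ‖w g p‖ * ‖wxC g p‖ := by
      refine (Complex.abs_re_le_norm _).trans ?_
      rw [norm_mul, norm_mul, Complex.norm_conj, Complex.norm_conj]; ring_nf; rfl
    have hB : |(conj (cy p) * (w g p * conj (2 * cy p))).re| ≤ ‖cy p‖ * ‖w g p‖ * ‖2 * cy p‖ := by
      refine (Complex.abs_re_le_norm _).trans ?_
      rw [norm_mul, norm_mul, Complex.norm_conj, Complex.norm_conj]; ring_nf; rfl
    have hAM : 2 * ε * (‖cx p‖ * ‖w g p‖ * ‖wxC g p‖) ≤ ‖w g p‖ ^ 2 * ‖wxC g p‖ ^ 2 + ε ^ 2 * ‖cx p‖ ^ 2 := by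
      nlinarith [sq_nonneg (‖w g p‖ * ‖wxC g p‖ - ε * ‖cx p‖)]
    have hell2 := deriv_ell_le_two (‖cy p‖ ^ 2)
    have hell0 := deriv_ell_nonneg (‖cy p‖ ^ 2)
    -- `ell'(‖y‖²) ‖y‖ ‖2y‖ ≤ 4` (the cut-off acts only where `‖y‖² < 1`)
    have hC : deriv ell (‖cy p‖ ^ 2) * (‖cy p‖ * ‖2 * cy p‖) ≤ 4 := by
      rcases lt_or_ge (‖cy p‖ ^ 2) 1 with hy | hy
      · have : ‖cy p‖ * ‖2 * cy p‖ = 2 * ‖cy p‖ ^ 2 := by rw [norm_mul]; norm_num; ring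
        rw [this]; nlinarith
      · rw [deriv_ell_of_ge hy]; norm_num
    have hwle : ‖w g p‖ ≤ 1 / 2 := by nlinarith [norm_nonneg (w g p)]
    -- lower bound for `N' = ‖wxC‖² + 8‖y‖²` hmm: `‖w‖² N ≥ (1/8) N`
    have hNlow : 9 / 16 ≤ N := by
      -- `‖y‖² + ‖x‖^{2g+1} ≥ ‖1 + w‖ ≥ 1/2`
      have hsum : 1 / 2 ≤ ‖cy p‖ ^ 2 + ‖cx p‖ ^ (2 * g + 1) := by
        have h1 : cy p ^ 2 - cx p ^ (2 * g + 1) = w g p + 1 := by rw [cy_sq_eq]; ring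
        have h2 := norm_sub_le (cy p ^ 2) (cx p ^ (2 * g + 1))
        rw [h1, norm_pow, norm_pow] at h2
        have h3 : 1 / 2 ≤ ‖w g p + 1‖ := by
          have := norm_sub_norm_le (1 : ℂ) (-(w g p))
          rw [norm_one, norm_neg, sub_neg_eq_add, add_comm] at this
          linarith
        linarith
      have hy4 : ‖2 * cy p‖ ^ 2 = 4 * ‖cy p‖ ^ 2 := by rw [norm_mul, mul_pow]; norm_num
      rcases le_or_gt (1 / 4) (‖cy p‖ ^ 2) with hy | hy
      · have : 0 ≤ ‖wxC g p‖ ^ 2 := by positivity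
        rw [hN, hy4]; linarith
      · have hxq : 1 / 4 ≤ ‖cx p‖ ^ (2 * g + 1) := by linarith
        have hwx : 9 / 16 ≤ ‖wxC g p‖ ^ 2 := by
          have hn1 : (3 : ℝ) ≤ ((2 * g + 1 : ℕ) : ℝ) ∨ g = 0 := by
            rcases Nat.eq_zero_or_pos g with h0 | h0
            · exact Or.inr h0
            · left; push_cast; have := (Nat.cast_le (α := ℝ)).2 h0; push_cast at this; linarith
          rcases hn1 with hn3 | hg0
          · -- `g ≥ 1`: `‖x‖^{4g} ≥ 1/16`
            have hx16 : 1 / 16 ≤ ‖cx p‖ ^ (4 * g) := by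
              rcases le_or_gt 1 ‖cx p‖ with h1 | h1
              · exact le_trans (by norm_num) (one_le_pow₀ h1)
              · have hmono : ‖cx p‖ ^ (4 * g + 2) ≤ ‖cx p‖ ^ (4 * g) :=
                  pow_le_pow_of_le_one (norm_nonneg _) h1.le (by omega)
                have hsq : ‖cx p‖ ^ (4 * g + 2) = (‖cx p‖ ^ (2 * g + 1)) ^ 2 := by
                  rw [← pow_mul]; ring_nf
                rw [hsq] at hmono
                nlinarith
            have : ‖wxC g p‖ ^ 2 = ((2 * g + 1 : ℕ) : ℝ) ^ 2 * ‖cx p‖ ^ (4 * g) := by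
              rw [wxC, norm_mul, norm_pow, Complex.norm_natCast, mul_pow, ← pow_mul,
                show 2 * g * 2 = 4 * g by ring]
            rw [this]
            nlinarith
          · subst hg0
            norm_num [wxC]
        have : 0 ≤ ‖2 * cy p‖ ^ 2 := by positivity
        rw [hN]; linarith
    -- assemble: `0 = DΨ(radV) ≥ 2‖w‖²N - (‖w‖²‖wxC‖² + ε²‖x‖²) - 8ε'‖w‖`
    have hc0 : 0 ≤ ‖w g p‖ ^ 2 * ‖2 * cy p‖ ^ 2 := by positivity
    have e2 : ‖w g p‖ ^ 2 * N = ‖w g p‖ ^ 2 * ‖wxC g p‖ ^ 2 + ‖w g p‖ ^ 2 * ‖2 * cy p‖ ^ 2 := by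
      rw [hN]; ring
    have hwN : (1 / 8) * N ≤ ‖w g p‖ ^ 2 * N := mul_le_mul_of_nonneg_right hw (by positivity)
    have hεx : ε ^ 2 * ‖cx p‖ ^ 2 ≤ ε * (1 / 4) := by nlinarith
    have h2ε' : (0 : ℝ) ≤ 2 * ε' := by positivity
    have hpos2 : 0 ≤ 2 * ε' * deriv ell (‖cy p‖ ^ 2) := mul_nonneg h2ε' hell0
    have hT2 : |2 * ε' * deriv ell (‖cy p‖ ^ 2) * (conj (cy p) * (w g p * conj (2 * cy p))).re| ≤
        2 * ε' * 4 * ‖w g p‖ := by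
      rw [abs_mul, abs_of_nonneg hpos2]
      calc 2 * ε' * deriv ell (‖cy p‖ ^ 2) * |(conj (cy p) * (w g p * conj (2 * cy p))).re|
          ≤ 2 * ε' * deriv ell (‖cy p‖ ^ 2) * (‖cy p‖ * ‖w g p‖ * ‖2 * cy p‖) :=
            mul_le_mul_of_nonneg_left hB hpos2
        _ = 2 * ε' * (deriv ell (‖cy p‖ ^ 2) * (‖cy p‖ * ‖2 * cy p‖)) * ‖w g p‖ := by ring
        _ ≤ 2 * ε' * 4 * ‖w g p‖ :=
            mul_le_mul_of_nonneg_right (mul_le_mul_of_nonneg_left hC h2ε') (norm_nonneg _)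
    have h2ε : (0 : ℝ) ≤ 2 * ε := by positivity
    have hT1 : |2 * ε * (conj (cx p) * (w g p * conj (wxC g p))).re| ≤
        ‖w g p‖ ^ 2 * ‖wxC g p‖ ^ 2 + ε ^ 2 * ‖cx p‖ ^ 2 := by
      rw [abs_mul, abs_of_nonneg h2ε]
      exact (mul_le_mul_of_nonneg_left hA h2ε).trans hAM
    have h8 : 8 * ε' * ‖w g p‖ ≤ 8 * ε' * (1 / 2) := mul_le_mul_of_nonneg_left hwle (by positivity)
    have a1 := abs_le.1 hT1
    have a2 := abs_le.1 hT2
    have hmain : 2 * (‖w g p‖ ^ 2 * N) ≤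
        (‖w g p‖ ^ 2 * ‖wxC g p‖ ^ 2 + ε ^ 2 * ‖cx p‖ ^ 2) + 2 * ε' * 4 * ‖w g p‖ := by
      linarith [a1.1, a1.2, a2.1, a2.2]
    linarith

/-- **`1/4` is a regular value of the model potential** (`0 < ε ≤ 1/80`, `0 < ε' ≤ ε/5000`).
[folklore] -/
theorem isRegularLevel_modelPsi {g : ℕ} {ε ε' : ℝ} (hε : 0 < ε) (hε80 : ε ≤ 1 / 80) (hε' : 0 < ε')
    (hε'le : ε' * 5000 ≤ ε) : IsRegularLevel (𝓡 4) (modelPsi g ε ε') (1 / 4) := by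
  refine isRegularLevel_of_not_isMCriticalPt (contDiff_modelPsi g ε ε').contMDiff fun p hp => ?_
  have hne := modelPsiD_ne_zero hε hε80 hε' hε'le hp
  obtain ⟨v, hv⟩ : ∃ v, modelPsiD g ε ε' p v ≠ 0 := by
    by_contra h
    push Not at h
    exact hne (ContinuousLinearMap.ext h)
  refine not_isMCriticalPt_of_fderiv_apply_ne (v := v) ?_
  rwa [fderiv_modelPsi]

/-- **The sublevel sets `{Ψ ≤ c}` are compact** (`ε > 0`, `ε' ≥ 0`): `‖x‖² ≤ c/ε`, `‖w‖² ≤ c` and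
`‖y‖² = ‖w + 1 + x^{2g+1}‖` bound `‖p‖`. [folklore] -/
theorem isCompact_modelPsi_le {g : ℕ} {ε ε' : ℝ} (hε : 0 < ε) (hε' : 0 ≤ ε') (c : ℝ) :
    IsCompact (modelPsi g ε ε' ⁻¹' Iic c) := by
  refine Metric.isCompact_of_isClosed_isBounded
    (isClosed_Iic.preimage (contDiff_modelPsi g ε ε').continuous) ?_
  rw [isBounded_iff_forall_norm_le]
  -- `a² ≤ c ⇒ a ≤ max 1 c` for `a ≥ 0`
  have key : ∀ {a c : ℝ}, 0 ≤ a → a ^ 2 ≤ c → a ≤ max 1 c := by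
    intro a c ha h
    rcases le_or_gt a 1 with h1 | h1
    · exact h1.trans (le_max_left _ _)
    · have : a ≤ a ^ 2 := by nlinarith
      exact (this.trans h).trans (le_max_right _ _)
  set Cx : ℝ := max 1 (c / ε) with hCx
  set Cw : ℝ := max 1 c with hCw
  set R : ℝ := Cx ^ 2 + (Cw + 1 + Cx ^ (2 * g + 1)) with hR
  refine ⟨max 1 R, fun p hp => ?_⟩
  have hp' : modelPsi g ε ε' p ≤ c := hp
  obtain ⟨hw2, hx2⟩ := bounds_of_modelPsi_le hε.le hε' hp'
  have hx : ‖cx p‖ ≤ Cx := key (norm_nonneg _) (by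
    rw [le_div_iff₀ hε]; linarith)
  have hw : ‖w g p‖ ≤ Cw := key (norm_nonneg _) hw2
  have hCx0 : 0 ≤ Cx := le_trans zero_le_one (le_max_left _ _)
  have hy : ‖cy p‖ ^ 2 ≤ Cw + 1 + Cx ^ (2 * g + 1) := by
    rw [← norm_pow, cy_sq_eq g p]
    calc ‖w g p + 1 + cx p ^ (2 * g + 1)‖ ≤ ‖w g p + 1‖ + ‖cx p ^ (2 * g + 1)‖ := norm_add_le _ _
      _ ≤ (‖w g p‖ + 1) + ‖cx p‖ ^ (2 * g + 1) := by
          rw [norm_pow]; exact add_le_add ((norm_add_le _ _).trans (by simp)) le_rfl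
      _ ≤ Cw + 1 + Cx ^ (2 * g + 1) := by
          have := pow_le_pow_left₀ (norm_nonneg (cx p)) hx (2 * g + 1)
          linarith
  have hn : ‖p‖ ^ 2 ≤ R := by
    rw [norm_sq_eq p, hR]
    have := pow_le_pow_left₀ (norm_nonneg (cx p)) hx 2
    linarith
  exact key (norm_nonneg _) hn

/-- **The level `{Ψ = 1/4}` is inhabited**: the point `(t, √(t^{2g+1} + 1))`,
`t = √((1/4 - ε' e⁻¹)/ε)`, of the central page `w = 0`. [folklore] -/
theorem exists_modelPsi_eq {g : ℕ} {ε ε' : ℝ} (hε : 0 < ε) (hε' : 0 ≤ ε') (hε'50 : ε' ≤ 1 / 50) :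
    ∃ p : EuclideanSpace ℝ (Fin 4), modelPsi g ε ε' p = 1 / 4 ∧ w g p = 0 := by
  have he1 : Real.exp (-1) ≤ 1 := by
    rw [Real.exp_neg]; exact inv_le_one_of_one_le₀ (Real.one_le_exp zero_le_one)
  have hq : 0 ≤ (1 / 4 - ε' * Real.exp (-1)) / ε := by
    apply div_nonneg _ hε.le
    nlinarith [Real.exp_pos (-1)]
  set t : ℝ := Real.sqrt ((1 / 4 - ε' * Real.exp (-1)) / ε) with ht
  have ht0 : 0 ≤ t := Real.sqrt_nonneg _
  have ht2 : t ^ 2 = (1 / 4 - ε' * Real.exp (-1)) / ε := Real.sq_sqrt hq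
  have hs0 : 0 ≤ t ^ (2 * g + 1) + 1 := by positivity
  set s : ℝ := Real.sqrt (t ^ (2 * g + 1) + 1) with hs
  have hs2 : s ^ 2 = t ^ (2 * g + 1) + 1 := Real.sq_sqrt hs0
  refine ⟨mk (t : ℂ) (s : ℂ), ?_, ?_⟩
  · have hw : w g (mk (t : ℂ) (s : ℂ)) = 0 := by
      simp only [w, Phi, cx_mk, cy_mk]
      have : ((s : ℂ)) ^ 2 = ((t ^ (2 * g + 1) + 1 : ℝ) : ℂ) := by rw [← Complex.ofReal_pow, hs2]
      rw [this]; push_cast; ring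
    have hy : ‖cy (mk (t : ℂ) (s : ℂ))‖ ^ 2 = t ^ (2 * g + 1) + 1 := by
      rw [cy_mk, Complex.norm_real, Real.norm_eq_abs, sq_abs, hs2]
    have hy1 : 1 ≤ ‖cy (mk (t : ℂ) (s : ℂ))‖ ^ 2 := by
      rw [hy]; have : 0 ≤ t ^ (2 * g + 1) := by positivity
      linarith
    simp only [modelPsi, hw, norm_zero, cx_mk, Complex.norm_real, Real.norm_eq_abs, sq_abs,
      ell_eq_of_le hy1]
    rw [ht2]
    field_simp
    ring
  · simp only [w, Phi, cx_mk, cy_mk]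
    have : ((s : ℂ)) ^ 2 = ((t ^ (2 * g + 1) + 1 : ℝ) : ℂ) := by rw [← Complex.ofReal_pow, hs2]
    rw [this]; push_cast; ring

/-- On `{Ψ ≤ 1/4}` one has `‖w‖ ≤ 1/2`. [folklore] -/
theorem norm_w_le_half_of_modelPsi_le {g : ℕ} {ε ε' : ℝ} (hε : 0 ≤ ε) (hε' : 0 ≤ ε')
    {p : EuclideanSpace ℝ (Fin 4)} (hp : modelPsi g ε ε' p ≤ 1 / 4) : ‖w g p‖ ≤ 1 / 2 := by
  have h := (bounds_of_modelPsi_le hε hε' hp).1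
  nlinarith [norm_nonneg (w g p)]

end LefschetzBaseSteinModel

/-! ### §5 A Stein structure on a regular sublevel set from a flat strictly plurisubharmonic
potential -/

section FlatPotential

open LefschetzBaseSteinModel

variable {f : EuclideanSpace ℝ (Fin 4) → ℝ} {c : ℝ} (h : IsRegularLevel (𝓡 4) f c)
  (J₀ : EuclideanSpace ℝ (Fin 4) →L[ℝ] EuclideanSpace ℝ (Fin 4)) (Ψ : EuclideanSpace ℝ (Fin 4) → ℝ)

/-- The potential `Ψ ∘ ι` on the regular sublevel set `{f ≤ c}` (the defining function `f` and the
potential `Ψ` need not coincide). [folklore] -/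
def potPhi : RegularSublevel h → ℝ := fun x => Ψ (RegularSublevel.incl h x)

/-- Unfolding `potPhi`. [folklore] -/
theorem potPhi_apply (x : RegularSublevel h) : potPhi h Ψ x = Ψ (RegularSublevel.incl h x) := rfl

variable {Ψ}

/-- `Ψ ∘ ι` is smooth. [folklore] -/
theorem contMDiff_potPhi (hΨ : ContDiff ℝ ∞ Ψ) : ContMDiff (𝓡∂ 4) 𝓘(ℝ, ℝ) ∞ (potPhi h Ψ) :=
  hΨ.comp_contMDiff (contMDiff_incl_four h)

/-- `d(Ψ ∘ ι)_x = dΨ_{ι x} ∘ Dι_x`. [folklore] -/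
theorem mfderiv_potPhi (hΨ : ContDiff ℝ ∞ Ψ) (x : RegularSublevel h) :
    mfderiv (𝓡∂ 4) 𝓘(ℝ, ℝ) (potPhi h Ψ) x =
      (fderiv ℝ Ψ (RegularSublevel.incl h x)).comp
        (inclDeriv h x : EuclideanSpace ℝ (Fin 4) →L[ℝ] EuclideanSpace ℝ (Fin 4)) := by
  have hΨ' : MDifferentiableAt (𝓡 4) 𝓘(ℝ, ℝ) Ψ (RegularSublevel.incl h x) :=
    ((hΨ.differentiable (by simp)) _).mdifferentiableAt
  have hι : MDifferentiableAt (𝓡∂ 4) (𝓡 4) (RegularSublevel.incl h) x :=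
    (contMDiff_incl_four h x).mdifferentiableAt (by simp)
  rw [show potPhi h Ψ = Ψ ∘ RegularSublevel.incl h from rfl, mfderiv_comp x hΨ' hι, mfderiv_eq_fderiv]
  rfl

/-- `d(Ψ ∘ ι)_x (v) = dΨ_{ι x} (Dι_x v)`. [folklore] -/
theorem mfderiv_potPhi_apply (hΨ : ContDiff ℝ ∞ Ψ) (x : RegularSublevel h) (v : EuclideanSpace ℝ (Fin 4)) :
    mfderiv (𝓡∂ 4) 𝓘(ℝ, ℝ) (potPhi h Ψ) x v = fderiv ℝ Ψ (RegularSublevel.incl h x) (inclDeriv h x v) := by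
  rw [mfderiv_potPhi h hΨ]
  rfl

/-- `d^ℂ(Ψ ∘ ι) = ι^*(d^ℂΨ)` for the transported constant complex structure. [folklore] -/
theorem dComplex_potPhi_eq_pullback (hΨ : ContDiff ℝ ∞ Ψ) :
    dComplex (sublevelJ h J₀) (potPhi h Ψ) =
      Kaehler.MForm.pullback (I' := 𝓡 4) (𝓡∂ 4) (RegularSublevel.incl h) (dComplexFlat J₀ Ψ) := by
  funext x
  ext v
  rw [dComplex_apply, mfderiv_potPhi_apply h hΨ, inclDeriv_sublevelJ, Kaehler.MForm.pullback_apply]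
  erw [dComplexFlat_apply]
  rfl

/-- `dd^ℂ(Ψ ∘ ι)_x = (dd^ℂΨ)_{ι x} ∘ (Dι_x × Dι_x)`. [folklore] -/
theorem mextDeriv_dComplex_potPhi (hΨ : ContDiff ℝ ∞ Ψ) (x : RegularSublevel h) :
    Kaehler.mextDeriv (dComplex (sublevelJ h J₀) (potPhi h Ψ)) x =
      (extDeriv (dComplexFlat J₀ Ψ) (RegularSublevel.incl h x)).compContinuousLinearMap
        (inclDeriv h x : EuclideanSpace ℝ (Fin 4) →L[ℝ] EuclideanSpace ℝ (Fin 4)) := by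
  have hf : ∀ᶠ z in 𝓝 x, ContMDiffAt (𝓡∂ 4) (𝓡 4) ∞ (RegularSublevel.incl h) z :=
    Filter.Eventually.of_forall fun z => contMDiff_incl_four h z
  have hβ : Kaehler.MForm.SmoothAt (I := 𝓡 4) (M := EuclideanSpace ℝ (Fin 4)) (dComplexFlat J₀ Ψ)
      (RegularSublevel.incl h x) :=
    smoothAt_flat (contDiff_dComplexFlat J₀ hΨ) _
  rw [dComplex_potPhi_eq_pullback h J₀ hΨ, Kaehler.mextDeriv_pullback_apply hf hβ]
  ext v
  rw [Kaehler.MForm.pullback_apply, Kaehler.mextDeriv_eq_extDeriv]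
  rfl

/-- **The Levi form of `Ψ ∘ ι` is the flat Levi form of `Ψ` on ambient vectors.** [folklore] -/
theorem neg_mextDeriv_dComplex_potPhi_self (hΨ : ContDiff ℝ ∞ Ψ) (hJ : ∀ v, J₀ (J₀ v) = -v)
    (x : RegularSublevel h) (v : EuclideanSpace ℝ (Fin 4)) :
    -(Kaehler.mextDeriv (dComplex (sublevelJ h J₀) (potPhi h Ψ)) x ![v, sublevelJ h J₀ x v]) =
      fderiv ℝ (fderiv ℝ Ψ) (RegularSublevel.incl h x) (inclDeriv h x v) (inclDeriv h x v) +
        fderiv ℝ (fderiv ℝ Ψ) (RegularSublevel.incl h x) (J₀ (inclDeriv h x v))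
          (J₀ (inclDeriv h x v)) := by
  rw [mextDeriv_dComplex_potPhi h J₀ hΨ]
  change -(extDeriv (dComplexFlat J₀ Ψ) (RegularSublevel.incl h x)
    ((inclDeriv h x : EuclideanSpace ℝ (Fin 4) →L[ℝ] EuclideanSpace ℝ (Fin 4)) ∘ ![v, sublevelJ h J₀ x v])) = _
  have hv : ((inclDeriv h x : EuclideanSpace ℝ (Fin 4) →L[ℝ] EuclideanSpace ℝ (Fin 4)) ∘
      ![v, sublevelJ h J₀ x v]) = ![inclDeriv h x v, J₀ (inclDeriv h x v)] := by
    funext i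
    fin_cases i
    · rfl
    · simp [inclDeriv_sublevelJ]
  rw [hv, neg_extDeriv_dComplexFlat_self J₀ hΨ hJ]

/-- **A Stein structure on the regular sublevel set `{f ≤ c} ⊂ ℝ⁴` from a flat potential**: a
constant complex structure `J₀` (`J₀² = -1`) transported to `{f ≤ c}`, and a smooth `Ψ` which is
strictly `J₀`-plurisubharmonic at the points of `{f ≤ c}`, presents the boundary `{f = c}` as
its own level `{Ψ = c'}` (inhabited, `Ψ ≤ c'` on `{f ≤ c}`) and is regular there.  Then
`(J₀, Ψ ∘ ι)` is a Stein structure on `{f ≤ c}` (`SteinDomain.lean`; integrability by the flat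
Nijenhuis tensor, `J`-convexity by `neg_mextDeriv_dComplex_potPhi_self`).
[cite: CieliebakEliashberg2012, §2.2] -/
def steinStructureOfFlatPotential [CompactSpace (RegularSublevel h)] (hΨ : ContDiff ℝ ∞ Ψ)
    (hJ : ∀ v, J₀ (J₀ v) = -v) (c' : ℝ)
    (hconv : ∀ (x : RegularSublevel h) (u : EuclideanSpace ℝ (Fin 4)), u ≠ 0 →
      0 < fderiv ℝ (fderiv ℝ Ψ) (RegularSublevel.incl h x) u u +
        fderiv ℝ (fderiv ℝ Ψ) (RegularSublevel.incl h x) (J₀ u) (J₀ u))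
    (hlev : ∀ x : RegularSublevel h, f (RegularSublevel.incl h x) = c ↔ Ψ (RegularSublevel.incl h x) = c')
    (hle : ∀ x : RegularSublevel h, Ψ (RegularSublevel.incl h x) ≤ c')
    (hne : ∃ x : RegularSublevel h, Ψ (RegularSublevel.incl h x) = c')
    (hreg : ∀ x : RegularSublevel h, Ψ (RegularSublevel.incl h x) = c' →
      fderiv ℝ Ψ (RegularSublevel.incl h x) ≠ 0) :
    SteinStructure (RegularSublevel h) where
  J := sublevelJ h J₀
  φ := potPhi h Ψ
  J_sq := sublevelJ_sq h J₀ hJ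
  J_smooth := isSmoothVectorField_sublevelJ h J₀
  integrable X Y hX hY x := nijenhuis_sublevelJ_eq_zero h J₀ hJ hX hY x
  φ_smooth := contMDiff_potPhi h hΨ
  convex x v hv := by
    rw [neg_mextDeriv_dComplex_potPhi_self h J₀ hΨ hJ]
    exact hconv x _ fun h0 => hv ((inclDeriv h x).map_eq_zero_iff.1 h0)
  boundary_eq x := by
    have hsup : sSup (range (potPhi h Ψ)) = c' := by
      obtain ⟨x₀, hx₀⟩ := hne
      have h1 : IsGreatest (range (potPhi h Ψ)) c' := by
        refine ⟨⟨x₀, hx₀⟩, ?_⟩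
        rintro _ ⟨y, rfl⟩
        exact hle y
      exact h1.csSup_eq
    rw [hsup, RegularSublevel.isBoundaryPoint_iff h x]
    exact hlev x
  regular x hx := by
    rw [RegularSublevel.isBoundaryPoint_iff h x] at hx
    have hx' := hreg x ((hlev x).1 hx)
    intro h0
    apply hx'
    ext u
    have h1 := mfderiv_potPhi_apply h hΨ x ((inclDeriv h x).symm u)
    rw [h0, ContinuousLinearEquiv.apply_symm_apply] at h1
    exact h1.symm

/-- The complex structure of `steinStructureOfFlatPotential` is the transported `J₀`. [folklore] -/
@[simp] theorem steinStructureOfFlatPotential_J [CompactSpace (RegularSublevel h)] (hΨ : ContDiff ℝ ∞ Ψ)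
    (hJ : ∀ v, J₀ (J₀ v) = -v) (c' : ℝ) (hconv) (hlev) (hle) (hne) (hreg) :
    (steinStructureOfFlatPotential h J₀ hΨ hJ c' hconv hlev hle hne hreg).J = sublevelJ h J₀ := rfl

/-- The potential of `steinStructureOfFlatPotential` is `Ψ ∘ ι`. [folklore] -/
@[simp] theorem steinStructureOfFlatPotential_φ [CompactSpace (RegularSublevel h)] (hΨ : ContDiff ℝ ∞ Ψ)
    (hJ : ∀ v, J₀ (J₀ v) = -v) (c' : ℝ) (hconv) (hlev) (hle) (hne) (hreg) :
    (steinStructureOfFlatPotential h J₀ hΨ hJ c' hconv hlev hle hne hreg).φ = potPhi h Ψ := rfl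

end FlatPotential

/-! ### §6 The model Stein domain `{Ψ ≤ 1/4}` -/

namespace LefschetzBaseSteinModel

/-- Admissible parameters of the model: `0 < ε ≤ 1/80`, `0 < ε'`, `5000 (2g+1)² ε' ≤ ε`. [folklore] -/
structure Admissible (g : ℕ) (ε ε' : ℝ) : Prop where
  ε_pos : 0 < ε
  ε_le : ε ≤ 1 / 80
  ε'_pos : 0 < ε'
  ε'_le : ε' * (5000 * (2 * g + 1) ^ 2) ≤ ε

namespace Admissible

variable {g : ℕ} {ε ε' : ℝ} (ha : Admissible g ε ε')
include ha

/-- `ε ≤ 1`. [folklore] -/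
theorem ε_le_one : ε ≤ 1 := ha.ε_le.trans (by norm_num)

/-- `ε' · 5000 ≤ ε`. [folklore] -/
theorem ε'_mul_le : ε' * 5000 ≤ ε := by
  have h1 : (1 : ℝ) ≤ (2 * g + 1) ^ 2 := by
    have : (1 : ℝ) ≤ 2 * g + 1 := by have := Nat.cast_nonneg (α := ℝ) g; linarith
    nlinarith
  nlinarith [ha.ε'_le, ha.ε'_pos]

/-- `ε' ≤ 1/50`. [folklore] -/
theorem ε'_le_fiftieth : ε' ≤ 1 / 50 := by linarith [ha.ε'_mul_le, ha.ε_le]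

/-- `1/4` is a regular value. [folklore] -/
theorem isRegularLevel : IsRegularLevel (𝓡 4) (modelPsi g ε ε') (1 / 4) :=
  isRegularLevel_modelPsi ha.ε_pos ha.ε_le ha.ε'_pos ha.ε'_mul_le

/-- `{Ψ ≤ 1/4}` is compact. [folklore] -/
theorem compactSpace : CompactSpace (RegularSublevel ha.isRegularLevel) :=
  isCompact_iff_compactSpace.1 (isCompact_modelPsi_le ha.ε_pos ha.ε'_pos.le (1 / 4))

/-- The flat Levi form of `Ψ` is positive definite at the points of `{Ψ ≤ 1/4}`. [folklore] -/
theorem levi_pos (x : RegularSublevel ha.isRegularLevel) {u : EuclideanSpace ℝ (Fin 4)} (hu : u ≠ 0) :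
    0 < fderiv ℝ (fderiv ℝ (modelPsi g ε ε')) (RegularSublevel.incl _ x) u u +
      fderiv ℝ (fderiv ℝ (modelPsi g ε ε')) (RegularSublevel.incl _ x) (stdComplexStructure u)
        (stdComplexStructure u) :=
  levi_modelPsi_pos ha.ε_pos ha.ε_le_one ha.ε'_pos ha.ε'_le
    ((norm_w_le_half_of_modelPsi_le ha.ε_pos.le ha.ε'_pos.le
      (RegularSublevel.apply_incl_le ha.isRegularLevel x)).trans (by norm_num)) hu

/-- The level `{Ψ = 1/4}` is inhabited. [folklore] -/
theorem exists_eq : ∃ x : RegularSublevel ha.isRegularLevel, modelPsi g ε ε' (RegularSublevel.incl _ x) = 1 / 4 := by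
  obtain ⟨p, hp, -⟩ := exists_modelPsi_eq (g := g) ha.ε_pos ha.ε'_pos.le ha.ε'_le_fiftieth
  exact ⟨RegularSublevel.mk _ p hp.le, hp⟩

/-- `dΨ ≠ 0` on the level. [folklore] -/
theorem fderiv_ne_zero (x : RegularSublevel ha.isRegularLevel)
    (hx : modelPsi g ε ε' (RegularSublevel.incl _ x) = 1 / 4) :
    fderiv ℝ (modelPsi g ε ε') (RegularSublevel.incl _ x) ≠ 0 := by
  rw [fderiv_modelPsi]; exact modelPsiD_ne_zero ha.ε_pos ha.ε_le ha.ε'_pos ha.ε'_mul_le hx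

end Admissible

/-- The standard `ε = 1/1000` (any `0 < ε ≤ 1/80` is admissible; the sequel's boundary estimates
want `ε ≤ 1/1000`). [folklore] -/
abbrev εstd : ℝ := 1 / 1000

/-- The standard `ε' = ε / (5000 (2g+1)²)`. [folklore] -/
abbrev ε'std (g : ℕ) : ℝ := εstd / (5000 * (2 * g + 1) ^ 2)

/-- **Standard admissible parameters**: `ε = 1/1000`, `ε' = ε / (5000 (2g+1)²)`. [folklore] -/
theorem admissible_std (g : ℕ) : Admissible g εstd (ε'std g) := by
  have hpos : (0 : ℝ) < 5000 * (2 * g + 1) ^ 2 := by positivity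
  refine ⟨by norm_num [εstd], by norm_num [εstd], by simp only [ε'std, εstd]; positivity, ?_⟩
  simp only [ε'std]
  rw [div_mul_cancel₀ _ hpos.ne']

/-- **The model domain of genus `g`**: `Ω_g = {Ψ_g ≤ 1/4} ⊂ ℂ²` for the standard parameters, a
compact smooth `4`-manifold with boundary (`RegularSublevel`). [folklore] -/
abbrev Model (g : ℕ) : Type := RegularSublevel (admissible_std g).isRegularLevel

/-- The model domain is compact. [folklore] -/
instance compactSpace_model (g : ℕ) : CompactSpace (Model g) := (admissible_std g).compactSpace

/-- **The model Stein structure**: `J₀ = stdComplexStructure` transported to `Ω_g` and the potential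
`Ψ_g|_{Ω_g}`. [cite: CieliebakEliashberg2012, §2.2] -/
def modelStein (g : ℕ) : SteinStructure (Model g) :=
  steinStructureOfFlatPotential (admissible_std g).isRegularLevel stdComplexStructure
    (contDiff_modelPsi g _ _) stdComplexStructure_sq (1 / 4)
    (fun x _ hu => (admissible_std g).levi_pos x hu) (fun _ => Iff.rfl)
    (fun x => RegularSublevel.apply_incl_le _ x) (admissible_std g).exists_eq
    (admissible_std g).fderiv_ne_zero

/-- The model Stein structure has `J = sublevelJ stdComplexStructure`. [folklore] -/
theorem modelStein_J (g : ℕ) :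
    (modelStein g).J = sublevelJ (admissible_std g).isRegularLevel stdComplexStructure := rfl

/-- The model Stein structure has potential `Ψ|_Ω`. [folklore] -/
theorem modelStein_φ (g : ℕ) :
    (modelStein g).φ = potPhi (admissible_std g).isRegularLevel (modelPsi g εstd (ε'std g)) := rfl

/-- **The model `Ω_g ⊂ ℂ²` is a Stein domain.** [cite: CieliebakEliashberg2012, §2.2] -/
theorem isSteinDomain_model (g : ℕ) : IsSteinDomain (Model g) := ⟨modelStein g⟩

end LefschetzBaseSteinModel

end Literature.Geometry.Symplectic
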